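import Literature.Probability.LatticeModels.DiscreteRectBoundaryLoop
import Literature.Probability.LatticeModels.WeakBeurlingEstimate
import HarnessLib

/-!
# The separation lemma for discrete topological rectangles

Topic `Literature/Probability/LatticeModels` (family `crit-ising`); support file for the named fact
`Literature.Probability.LatticeModels.fkIsing_topologicalRectangle_crossingBounds` (D. Chelkak,
H. Duminil-Copin, C. Hongler, *Crossing probabilities in topological rectangles for the critical
planar FK-Ising model*, Electron. J. Probab. 21 (2016), no. 5, Thm. 1.1). Throughout CDH16 §4 (and in
every planar-duality argument for discrete domains) one uses that, in a simply connected discrete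
domain `Ω` with boundary arcs `(ab), (bc), (cd), (da)` in cyclic order, a path of `Ω` joining `(ab)` to
`(cd)` and a path joining `(bc)` to `(da)` "topologically must intersect" (CDH16, proof of Lemma 4.5).
For the tree's presentations `DiscreteRect.IsRect E d₀ n` — one boundary-tracing orbit through all
external darts, cut into four arcs — this is proved here
(`DiscreteRect.IsRect.exists_mem_support_inter`, vertex form
`DiscreteRect.IsRect.exists_mem_support_inter_of_mem_arcVerts`), by an intersection-number argument in
the eightfold refined lattice built on the offset boundary loop of `DiscreteRectBoundaryLoop.lean` and
the lattice winding number `walkWinding` of `Percolation/PlanarDuality.lean`: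

* traversal counts of straight runs (`sum_vCross_run_*`, `sum_hCross_run_*`) and of connector pieces
  at their two ends (`sum_vCross_oconn_start/end`, `sum_hCross_oconn_start/end`: the loop passes
  through the offset point of a dart perpendicularly to the dart, counterclockwise);
* the support of a connector piece in dart coordinates (`mem_support_oconn`, `mem_support_oconn_cases`:
  start, end, or strictly inside the exterior square), offset points (`opt_injective`, `opt_ne_opt`),
  and **disjointness of connector pieces of different offsets** (`oconn_support_disjoint`,
  `oloop_support_disjoint`): an interior point determines its exterior square (`ediv_eq_quad`), and
  within one square the hug sets of the darts at its corners are disjoint for offsets `o ≠ o'`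
  (`false_of_sameSquare`, a finite check by `omega` over the sides of the square present in `E`,
  `DiscreteRect.sideE`);
* eightfold refinement of lattice walks (`DiscreteRect.refine`, `mem_support_refine`), interior points
  of refined edges (`eq_or_rev_of_interior_eq`, `edge_eq_of_interior_eq`, `eq_ends_of_eq_smul`), spurs
  (`DiscreteRect.spur`); the closed-walk winding constancy lemmas are those of
  `WeakBeurlingEstimate.lean` (`WeakBeurling.walkWinding_closed_eq_of_walk`);
* **the separation lemma**: if `P₁ : (ab) → (cd)` and `P₂ : (bc) → (da)` were vertex-disjoint, close
  the refinement of `P₁` through the offset-`2` loop from `(cd)` round `(da)` to `(ab)` into a closed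
  refined walk `W`; the closed itinerary "refined `P₂`, spur out at its end on `(da)` to offset `3`,
  offset-`3` loop round `(ab)` back to `(bc)`, spur in" avoids `W` except where the first spur crosses
  the offset-`2` loop, and there the winding number of `W` drops by exactly `1`; summing the jumps of
  the winding number of `W` round the closed itinerary gives `0 = -1`.

## References
* D. Chelkak, H. Duminil-Copin, C. Hongler, EJP 21 (2016) no. 5, §2.1 (simply connected discrete
  domains), §4 (proof of Lemma 4.5: "topologically, it must intersect any crossing").
  [ChelkakDuminilCopinHongler2016]
* H. Kesten, *Percolation theory for mathematicians*, Birkhäuser (1982), §2.2 (winding numbers and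
  planarity arguments for lattice paths). [KestenPTM1982]
-/

noncomputable section

namespace Literature.Probability.LatticeModels

namespace DiscreteRect

open SimpleGraph Literature.Probability.Percolation

variable {E : Finset (Sym2 (Site 2))}

/-- The four elements of `Fin 4`. [folklore] -/
private theorem fin_four_eq' (k : Fin 4) : k = 0 ∨ k = 1 ∨ k = 2 ∨ k = 3 := by
  fin_cases k <;> simp

/-! ### Signed edge-traversal counts of straight runs -/

section RunCross

/-- Traversals of the vertical edge right of `u` by a run to the right: none. [folklore] -/
theorem sum_vCross_run_zero (p : Site 2) (L : ℕ) (u : Site 2) :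
    ((run 0 p L).darts.map fun d ↦ vCross u d.fst d.snd).sum = 0 := by
  induction L generalizing p with
  | zero => rfl
  | succ L ih =>
    show (((Walk.cons (adj_add_dir p 0) (run 0 (p + dir 0) L)).darts.map
      fun d ↦ vCross u d.fst d.snd).sum) = 0
    rw [Walk.darts_cons, List.map_cons, List.sum_cons, ih]
    unfold vCross
    simp only [Pi.add_apply, dir_zero_apply_zero, dir_zero_apply_one, add_zero]
    split_ifs <;> omega

/-- Traversals of the vertical edge right of `u` by a run to the left: none. [folklore] -/
theorem sum_vCross_run_two (p : Site 2) (L : ℕ) (u : Site 2) :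
    ((run 2 p L).darts.map fun d ↦ vCross u d.fst d.snd).sum = 0 := by
  induction L generalizing p with
  | zero => rfl
  | succ L ih =>
    show (((Walk.cons (adj_add_dir p 2) (run 2 (p + dir 2) L)).darts.map
      fun d ↦ vCross u d.fst d.snd).sum) = 0
    rw [Walk.darts_cons, List.map_cons, List.sum_cons, ih]
    unfold vCross
    simp only [Pi.add_apply, dir_two_apply_zero, dir_two_apply_one, add_zero]
    split_ifs <;> omega

/-- Traversals of the vertical edge `{u + e₀, u + e₀ + e₁}` by an upward run of `L` steps from `p`:
`+1` iff the run lies on the line `x₀ = u₀ + 1` and passes from level `u₁` to `u₁ + 1`. [folklore] -/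
theorem sum_vCross_run_one (p : Site 2) (L : ℕ) (u : Site 2) :
    ((run 1 p L).darts.map fun d ↦ vCross u d.fst d.snd).sum =
      if p 0 = u 0 + 1 ∧ p 1 ≤ u 1 ∧ u 1 < p 1 + L then 1 else 0 := by
  induction L generalizing p with
  | zero =>
    show (((Walk.nil : (zdGraph 2).Walk p p).darts.map fun d ↦ vCross u d.fst d.snd).sum) = _
    simp only [Walk.darts_nil, List.map_nil, List.sum_nil, Nat.cast_zero, add_zero]
    split_ifs <;> omega
  | succ L ih =>
    show (((Walk.cons (adj_add_dir p 1) (run 1 (p + dir 1) L)).darts.map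
      fun d ↦ vCross u d.fst d.snd).sum) = _
    rw [Walk.darts_cons, List.map_cons, List.sum_cons, ih]
    unfold vCross
    simp only [Pi.add_apply, dir_one_apply_zero, dir_one_apply_one, add_zero, Nat.cast_succ]
    split_ifs <;> omega

/-- Traversals of the vertical edge `{u + e₀, u + e₀ + e₁}` by a downward run of `L` steps from
`p`: `-1` iff the run lies on the line `x₀ = u₀ + 1` and passes from level `u₁ + 1` to `u₁`.
[folklore] -/
theorem sum_vCross_run_three (p : Site 2) (L : ℕ) (u : Site 2) :
    ((run 3 p L).darts.map fun d ↦ vCross u d.fst d.snd).sum =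
      -(if p 0 = u 0 + 1 ∧ p 1 - L ≤ u 1 ∧ u 1 + 1 ≤ p 1 then 1 else 0) := by
  induction L generalizing p with
  | zero =>
    show (((Walk.nil : (zdGraph 2).Walk p p).darts.map fun d ↦ vCross u d.fst d.snd).sum) = _
    simp only [Walk.darts_nil, List.map_nil, List.sum_nil, Nat.cast_zero, sub_zero]
    split_ifs <;> omega
  | succ L ih =>
    show (((Walk.cons (adj_add_dir p 3) (run 3 (p + dir 3) L)).darts.map
      fun d ↦ vCross u d.fst d.snd).sum) = _
    rw [Walk.darts_cons, List.map_cons, List.sum_cons, ih]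
    unfold vCross
    simp only [Pi.add_apply, dir_three_apply_zero, dir_three_apply_one, add_zero, Nat.cast_succ]
    split_ifs <;> omega

/-- Traversals of the horizontal edge `{u + e₁, u + e₀ + e₁}` by a run to the right: `+1` iff the
run lies on the line `x₁ = u₁ + 1` and passes from `u₀` to `u₀ + 1`. [folklore] -/
theorem sum_hCross_run_zero (p : Site 2) (L : ℕ) (u : Site 2) :
    ((run 0 p L).darts.map fun d ↦ hCross u d.fst d.snd).sum =
      if p 1 = u 1 + 1 ∧ p 0 ≤ u 0 ∧ u 0 < p 0 + L then 1 else 0 := by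
  induction L generalizing p with
  | zero =>
    show (((Walk.nil : (zdGraph 2).Walk p p).darts.map fun d ↦ hCross u d.fst d.snd).sum) = _
    simp only [Walk.darts_nil, List.map_nil, List.sum_nil, Nat.cast_zero, add_zero]
    split_ifs <;> omega
  | succ L ih =>
    show (((Walk.cons (adj_add_dir p 0) (run 0 (p + dir 0) L)).darts.map
      fun d ↦ hCross u d.fst d.snd).sum) = _
    rw [Walk.darts_cons, List.map_cons, List.sum_cons, ih]
    unfold hCross
    simp only [Pi.add_apply, dir_zero_apply_zero, dir_zero_apply_one, add_zero, Nat.cast_succ]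
    split_ifs <;> omega

/-- Traversals of the horizontal edge `{u + e₁, u + e₀ + e₁}` by a run to the left: `-1` iff the
run lies on the line `x₁ = u₁ + 1` and passes from `u₀ + 1` to `u₀`. [folklore] -/
theorem sum_hCross_run_two (p : Site 2) (L : ℕ) (u : Site 2) :
    ((run 2 p L).darts.map fun d ↦ hCross u d.fst d.snd).sum =
      -(if p 1 = u 1 + 1 ∧ p 0 - L ≤ u 0 ∧ u 0 + 1 ≤ p 0 then 1 else 0) := by
  induction L generalizing p with
  | zero =>
    show (((Walk.nil : (zdGraph 2).Walk p p).darts.map fun d ↦ hCross u d.fst d.snd).sum) = _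
    simp only [Walk.darts_nil, List.map_nil, List.sum_nil, Nat.cast_zero, sub_zero]
    split_ifs <;> omega
  | succ L ih =>
    show (((Walk.cons (adj_add_dir p 2) (run 2 (p + dir 2) L)).darts.map
      fun d ↦ hCross u d.fst d.snd).sum) = _
    rw [Walk.darts_cons, List.map_cons, List.sum_cons, ih]
    unfold hCross
    simp only [Pi.add_apply, dir_two_apply_zero, dir_two_apply_one, add_zero, Nat.cast_succ]
    split_ifs <;> omega

/-- Traversals of the horizontal edge above `u` by a vertical run: none. [folklore] -/
theorem sum_hCross_run_one (p : Site 2) (L : ℕ) (u : Site 2) :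
    ((run 1 p L).darts.map fun d ↦ hCross u d.fst d.snd).sum = 0 := by
  induction L generalizing p with
  | zero => rfl
  | succ L ih =>
    show (((Walk.cons (adj_add_dir p 1) (run 1 (p + dir 1) L)).darts.map
      fun d ↦ hCross u d.fst d.snd).sum) = 0
    rw [Walk.darts_cons, List.map_cons, List.sum_cons, ih]
    unfold hCross
    simp only [Pi.add_apply, dir_one_apply_zero, dir_one_apply_one, add_zero]
    split_ifs <;> omega

/-- Traversals of the horizontal edge above `u` by a vertical run: none. [folklore] -/
theorem sum_hCross_run_three (p : Site 2) (L : ℕ) (u : Site 2) :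
    ((run 3 p L).darts.map fun d ↦ hCross u d.fst d.snd).sum = 0 := by
  induction L generalizing p with
  | zero => rfl
  | succ L ih =>
    show (((Walk.cons (adj_add_dir p 3) (run 3 (p + dir 3) L)).darts.map
      fun d ↦ hCross u d.fst d.snd).sum) = 0
    rw [Walk.darts_cons, List.map_cons, List.sum_cons, ih]
    unfold hCross
    simp only [Pi.add_apply, dir_three_apply_zero, dir_three_apply_one, add_zero]
    split_ifs <;> omega

end RunCross


/-! ### The support of a connector piece, in dart coordinates -/

section Support

/-- **Support of the offset connector in dart coordinates.** Every vertex of `oconn E o ho (x, k)` is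
`8x + a·e_k + b·e_{k+1}` with `(a, b)` on the hug set of the relevant case of `succ`: the `L` at the
corner (`a = o, b ≤ o` or `b = o, a ≤ o`), the segment `a = o, b ≤ 8`, the concave corner
(`a = o, b ≤ 8 - o` or `b = 8 - o, o ≤ a ≤ 8`), or the three sides (`a = o, b ≤ 8 - o` or
`b = 8 - o, o ≤ a ≤ 8 - o` or `a = 8 - o, b ≤ 8 - o`). [folklore] -/
theorem mem_support_oconn {o : ℕ} {ho : 2 * o ≤ 8} {x : Site 2} {k : Fin 4} {w : Site 2}
    (hw : w ∈ (oconn E o ho (x, k)).support) :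
    ∃ a b : ℕ, w = (8 : ℤ) • x + (a : ℤ) • dir k + (b : ℤ) • dir (k + 1) ∧
      ((s(x, x + dir (k + 1)) ∉ E ∧ ((a = o ∧ b ≤ o) ∨ (b = o ∧ a ≤ o))) ∨
       (s(x, x + dir (k + 1)) ∈ E ∧ s(x + dir (k + 1), x + dir (k + 1) + dir k) ∉ E ∧
          a = o ∧ b ≤ 8) ∨
       (s(x, x + dir (k + 1)) ∈ E ∧ s(x + dir (k + 1), x + dir (k + 1) + dir k) ∈ E ∧
          s(x + dir (k + 1) + dir k, x + dir (k + 1) + dir k + dir (k - 1)) ∉ E ∧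
          ((a = o ∧ b ≤ 8 - o) ∨ (b = 8 - o ∧ o ≤ a ∧ a ≤ 8))) ∨
       (s(x, x + dir (k + 1)) ∈ E ∧ s(x + dir (k + 1), x + dir (k + 1) + dir k) ∈ E ∧
          s(x + dir (k + 1) + dir k, x + dir (k + 1) + dir k + dir (k - 1)) ∈ E ∧
          ((a = o ∧ b ≤ 8 - o) ∨ (b = 8 - o ∧ o ≤ a ∧ a ≤ 8 - o) ∨ (a = 8 - o ∧ b ≤ 8 - o)))) := by
  have ho' : o ≤ 8 := by omega
  unfold oconn at hw
  dsimp only at hw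
  by_cases h1 : s(x, x + dir (k + 1)) ∉ E
  · rw [dif_pos h1, Walk.support_copy, Walk.mem_support_append_iff] at hw
    rcases hw with hw | hw
    · obtain ⟨t, ht, rfl⟩ := mem_support_run.1 hw
      refine ⟨o, t, ?_, Or.inl ⟨h1, Or.inl ⟨rfl, ht⟩⟩⟩
      simp only [opt]
    · rw [iterate_add_dir] at hw
      obtain ⟨t, ht, rfl⟩ := mem_support_run.1 hw
      refine ⟨o - t, o, ?_, Or.inl ⟨h1, Or.inr ⟨rfl, Nat.sub_le _ _⟩⟩⟩
      simp only [opt, dir_add_two, smul_neg]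
      push_cast [ht]
      simp only [sub_smul]
      abel
  · rw [dif_neg h1] at hw
    have h1' : s(x, x + dir (k + 1)) ∈ E := not_not.1 h1
    by_cases h2 : s(x + dir (k + 1), x + dir (k + 1) + dir k) ∉ E
    · rw [dif_pos h2, Walk.support_copy] at hw
      obtain ⟨t, ht, rfl⟩ := mem_support_run.1 hw
      refine ⟨o, t, ?_, Or.inr (Or.inl ⟨h1', h2, rfl, ht⟩)⟩
      simp only [opt]
    · rw [dif_neg h2] at hw
      have h2' : s(x + dir (k + 1), x + dir (k + 1) + dir k) ∈ E := not_not.1 h2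
      by_cases h3 : s(x + dir (k + 1) + dir k, x + dir (k + 1) + dir k + dir (k - 1)) ∉ E
      · rw [dif_pos h3, Walk.support_copy, Walk.mem_support_append_iff] at hw
        rcases hw with hw | hw
        · obtain ⟨t, ht, rfl⟩ := mem_support_run.1 hw
          refine ⟨o, t, ?_, Or.inr (Or.inr (Or.inl ⟨h1', h2', h3, Or.inl ⟨rfl, ht⟩⟩))⟩
          simp only [opt]
        · rw [iterate_add_dir] at hw
          obtain ⟨t, ht, rfl⟩ := mem_support_run.1 hw
          refine ⟨o + t, 8 - o, ?_, Or.inr (Or.inr (Or.inl ⟨h1', h2', h3, Or.inr ⟨rfl, by omega, by omega⟩⟩))⟩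
          simp only [opt]
          push_cast [ho']
          simp only [sub_smul, add_smul]
          abel
      · rw [dif_neg h3, Walk.support_copy, Walk.mem_support_append_iff,
          Walk.mem_support_append_iff] at hw
        have h3' : s(x + dir (k + 1) + dir k, x + dir (k + 1) + dir k + dir (k - 1)) ∈ E :=
          not_not.1 h3
        rcases hw with (hw | hw) | hw
        · obtain ⟨t, ht, rfl⟩ := mem_support_run.1 hw
          refine ⟨o, t, ?_, Or.inr (Or.inr (Or.inr ⟨h1', h2', h3', Or.inl ⟨rfl, ht⟩⟩))⟩
          simp only [opt]
        · rw [iterate_add_dir] at hw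
          obtain ⟨t, ht, rfl⟩ := mem_support_run.1 hw
          refine ⟨o + t, 8 - o, ?_,
            Or.inr (Or.inr (Or.inr ⟨h1', h2', h3', Or.inr (Or.inl ⟨rfl, by omega, by omega⟩)⟩))⟩
          simp only [opt]
          push_cast [ho']
          simp only [sub_smul, add_smul]
          abel
        · rw [iterate_add_dir, iterate_add_dir] at hw
          obtain ⟨t, ht, rfl⟩ := mem_support_run.1 hw
          refine ⟨8 - o, 8 - o - t, ?_,
            Or.inr (Or.inr (Or.inr ⟨h1', h2', h3', Or.inr (Or.inr ⟨rfl, Nat.sub_le _ _⟩)⟩))⟩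
          simp only [opt, dir_add_three, smul_neg]
          have ht' : t ≤ 8 - o := ht
          push_cast [ho', ho, ht']
          simp only [sub_smul, mul_smul]
          abel

/-- **Trichotomy for the vertices of a connector piece**: the start `opt o d`, the end
`opt o (succ E d)`, or a point strictly inside the exterior square (`0 < a, b < 8` in dart
coordinates). [folklore] -/
theorem mem_support_oconn_cases {o : ℕ} (ho0 : 0 < o) {ho : 2 * o ≤ 8} {x : Site 2} {k : Fin 4}
    {w : Site 2} (hw : w ∈ (oconn E o ho (x, k)).support) :
    w = opt o (x, k) ∨ w = opt o (succ E (x, k)) ∨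
      ∃ a b : ℕ, w = (8 : ℤ) • x + (a : ℤ) • dir k + (b : ℤ) • dir (k + 1) ∧
        0 < a ∧ a < 8 ∧ 0 < b ∧ b < 8 := by
  obtain ⟨a, b, rfl, hc⟩ := mem_support_oconn hw
  have ho' : o ≤ 8 := by omega
  -- the start point, in dart coordinates `(o, 0)`
  have hstart : ∀ {a b : ℕ}, a = o → b = 0 →
      ((8 : ℤ) • x + (a : ℤ) • dir k + (b : ℤ) • dir (k + 1)) = opt o (x, k) := by
    rintro a b rfl rfl
    simp [opt]
  rcases hc with ⟨h1, hab⟩ | ⟨h1, h2, ha, hb⟩ | ⟨h1, h2, h3, hab⟩ | ⟨h1, h2, h3, hab⟩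
  · rw [succ_of_not_mem h1]
    rcases hab with ⟨ha, hb⟩ | ⟨hb, ha⟩
    · rcases Nat.eq_zero_or_pos b with hb0 | hb0
      · exact Or.inl (hstart ha hb0)
      · exact Or.inr (Or.inr ⟨a, b, rfl, by omega, by omega, hb0, by omega⟩)
    · rcases Nat.eq_zero_or_pos a with rfl | ha0
      · refine Or.inr (Or.inl ?_)
        subst hb
        simp [opt]
      · exact Or.inr (Or.inr ⟨a, b, rfl, ha0, by omega, by omega, by omega⟩)
  · rw [succ_of_mem_of_not_mem (not_not.2 h1) h2]
    rcases Nat.eq_zero_or_pos b with hb0 | hb0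
    · exact Or.inl (hstart ha hb0)
    · rcases (show b < 8 ∨ b = 8 by omega) with hb8 | rfl
      · exact Or.inr (Or.inr ⟨a, b, rfl, by omega, by omega, hb0, hb8⟩)
      · refine Or.inr (Or.inl ?_)
        subst ha
        simp only [opt, smul_add]
        push_cast
        abel
  · rw [succ_of_mem_of_mem_of_not_mem (not_not.2 h1) (not_not.2 h2) h3]
    rcases hab with ⟨ha, hb⟩ | ⟨rfl, ha, ha'⟩
    · rcases Nat.eq_zero_or_pos b with hb0 | hb0
      · exact Or.inl (hstart ha hb0)
      · exact Or.inr (Or.inr ⟨a, b, rfl, by omega, by omega, hb0, by omega⟩)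
    · rcases (show a < 8 ∨ a = 8 by omega) with ha8 | rfl
      · exact Or.inr (Or.inr ⟨a, 8 - o, rfl, by omega, ha8, by omega, by omega⟩)
      · refine Or.inr (Or.inl ?_)
        simp only [opt, smul_add, dir_sub_one, smul_neg]
        push_cast [ho']
        simp only [sub_smul]
        abel
  · rw [succ_of_mem_of_mem_of_mem (not_not.2 h1) (not_not.2 h2) (not_not.2 h3)]
    rcases hab with ⟨ha, hb⟩ | ⟨rfl, ha, ha'⟩ | ⟨rfl, hb⟩
    · rcases Nat.eq_zero_or_pos b with hb0 | hb0
      · exact Or.inl (hstart ha hb0)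
      · exact Or.inr (Or.inr ⟨a, b, rfl, by omega, by omega, hb0, by omega⟩)
    · exact Or.inr (Or.inr ⟨a, 8 - o, rfl, by omega, by omega, by omega, by omega⟩)
    · rcases Nat.eq_zero_or_pos b with rfl | hb0
      · refine Or.inr (Or.inl ?_)
        simp only [opt, smul_add, dir_add_two, smul_neg, Nat.cast_zero, zero_smul, add_zero]
        push_cast [ho']
        simp only [sub_smul]
        abel
      · exact Or.inr (Or.inr ⟨8 - o, b, rfl, by omega, by omega, hb0, by omega⟩)

/-- A point strictly inside an exterior square (in dart coordinates) has both refined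
coordinates off the lattice lines: `w₀, w₁ ≢ 0 (mod 8)`. [folklore] -/
theorem mod_ne_zero_of_interior {x w : Site 2} {k : Fin 4} {a b : ℕ}
    (hw : w = (8 : ℤ) • x + (a : ℤ) • dir k + (b : ℤ) • dir (k + 1))
    (ha0 : 0 < a) (ha8 : a < 8) (hb0 : 0 < b) (hb8 : b < 8) :
    w 0 % 8 ≠ 0 ∧ w 1 % 8 ≠ 0 := by
  subst hw
  rcases fin_four_eq' k with rfl | rfl | rfl | rfl <;> simp <;> omega

/-- The offset point of a dart lies on a lattice line: one refined coordinate is `≡ 0 (mod 8)`.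
[folklore] -/
theorem opt_mod_eq_zero (o : ℕ) (d : Site 2 × Fin 4) : opt o d 0 % 8 = 0 ∨ opt o d 1 % 8 = 0 := by
  obtain ⟨x, k⟩ := d
  rcases fin_four_eq' k with rfl | rfl | rfl | rfl <;> simp [opt]

/-- **The offset point determines the dart** (`0 < o`, `2o < 8`; for `o = 4` the two darts of a
missing edge share their offset point). [folklore] -/
theorem opt_injective {o : ℕ} (ho0 : 0 < o) (ho8 : 2 * o < 8) : Function.Injective (opt o) := by
  rintro ⟨x, k⟩ ⟨x', k'⟩ h
  have h0 := congrFun h 0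
  have h1 := congrFun h 1
  rcases fin_four_eq' k with rfl | rfl | rfl | rfl <;>
    rcases fin_four_eq' k' with rfl | rfl | rfl | rfl <;>
    simp [opt] at h0 h1 ⊢ <;>
    first
    | omega
    | (refine Site.eq_iff_two.2 ⟨?_, ?_⟩ <;> omega)

/-- Offset points of different offsets `o ≠ o'` (`0 < o, o'`, `o + o' ≠ 8`) never coincide.
[folklore] -/
theorem opt_ne_opt {o o' : ℕ} (hne : o ≠ o') (ho0 : 0 < o) (ho8 : o < 8) (ho0' : 0 < o')
    (ho8' : o' < 8) (hsum : o + o' ≠ 8) (d d' : Site 2 × Fin 4) : opt o d ≠ opt o' d' := by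
  obtain ⟨x, k⟩ := d
  obtain ⟨x', k'⟩ := d'
  intro h
  have h0 := congrFun h 0
  have h1 := congrFun h 1
  rcases fin_four_eq' k with rfl | rfl | rfl | rfl <;>
    rcases fin_four_eq' k' with rfl | rfl | rfl | rfl <;>
    simp [opt] at h0 h1 <;> omega

end Support


/-! ### Sides of the exterior square and disjointness of connectors of different offsets -/

section Sides

/-- The `j`-th side `{corner j, corner (j+1)}` of the unit square with lower-left corner `S`.
[folklore] -/
def sideE (S : Site 2) (j : Fin 4) : Sym2 (Site 2) := s(corner S j, corner S (j + 1))

/-- The side of the exterior square on the missing edge of the dart `(x, k)`. [folklore] -/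
theorem sideE_quad_self (x : Site 2) (k : Fin 4) : sideE (quad x k) k = s(x, x + dir k) := by
  rw [sideE, corner_quad, corner_quad_add_one]

/-- The side of the exterior square tested first by `succ` (direction `e_{k+1}` at `x`). [folklore] -/
theorem sideE_quad_add_three (x : Site 2) (k : Fin 4) :
    sideE (quad x k) (k + 3) = s(x, x + dir (k + 1)) := by
  have key : ∀ k : Fin 4, k + 3 + 1 = k := by decide
  rw [sideE, key, corner_quad_add_three, corner_quad, Sym2.eq_swap]

/-- The side of the exterior square tested second by `succ`. [folklore] -/
theorem sideE_quad_add_two (x : Site 2) (k : Fin 4) :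
    sideE (quad x k) (k + 2) = s(x + dir (k + 1), x + dir (k + 1) + dir k) := by
  have key : ∀ k : Fin 4, k + 2 + 1 = k + 3 := by decide
  rw [sideE, key, corner_quad_add_two, corner_quad_add_three, Sym2.eq_swap, add_right_comm]

/-- The side of the exterior square tested third by `succ`. [folklore] -/
theorem sideE_quad_add_one (x : Site 2) (k : Fin 4) :
    sideE (quad x k) (k + 1) =
      s(x + dir (k + 1) + dir k, x + dir (k + 1) + dir k + dir (k - 1)) := by
  have key : ∀ k : Fin 4, k + 1 + 1 = k + 2 := by decide
  rw [sideE, key, corner_quad_add_one, corner_quad_add_two, Sym2.eq_swap, dir_sub_one,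
    add_right_comm x]
  congr 1
  abel

/-- `mem_support_oconn` with the case conditions expressed through the sides of the exterior
square `quad x k`. [folklore] -/
theorem mem_support_oconn_side {o : ℕ} {ho : 2 * o ≤ 8} {x : Site 2} {k : Fin 4} {w : Site 2}
    (hw : w ∈ (oconn E o ho (x, k)).support) :
    ∃ a b : ℕ, w = (8 : ℤ) • x + (a : ℤ) • dir k + (b : ℤ) • dir (k + 1) ∧
      ((sideE (quad x k) (k + 3) ∉ E ∧ ((a = o ∧ b ≤ o) ∨ (b = o ∧ a ≤ o))) ∨
       (sideE (quad x k) (k + 3) ∈ E ∧ sideE (quad x k) (k + 2) ∉ E ∧ a = o ∧ b ≤ 8) ∨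
       (sideE (quad x k) (k + 3) ∈ E ∧ sideE (quad x k) (k + 2) ∈ E ∧
          sideE (quad x k) (k + 1) ∉ E ∧ ((a = o ∧ b ≤ 8 - o) ∨ (b = 8 - o ∧ o ≤ a ∧ a ≤ 8))) ∨
       (sideE (quad x k) (k + 3) ∈ E ∧ sideE (quad x k) (k + 2) ∈ E ∧
          sideE (quad x k) (k + 1) ∈ E ∧
          ((a = o ∧ b ≤ 8 - o) ∨ (b = 8 - o ∧ o ≤ a ∧ a ≤ 8 - o) ∨ (a = 8 - o ∧ b ≤ 8 - o)))) := by
  rw [sideE_quad_add_three, sideE_quad_add_two, sideE_quad_add_one]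
  exact mem_support_oconn hw

/-- **An interior point determines its square**: in dart coordinates `0 < a, b < 8`, the refined
point `8x + a·e_k + b·e_{k+1}` lies strictly inside the refined exterior square, whose lower-left
corner `quad x k` is recovered by integer division by `8`. [folklore] -/
theorem ediv_eq_quad {x w : Site 2} {k : Fin 4} {a b : ℕ}
    (hw : w = (8 : ℤ) • x + (a : ℤ) • dir k + (b : ℤ) • dir (k + 1))
    (ha0 : 0 < a) (ha8 : a < 8) (hb0 : 0 < b) (hb8 : b < 8) :
    w 0 / 8 = quad x k 0 ∧ w 1 / 8 = quad x k 1 := by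
  subst hw
  rcases fin_four_eq' k with rfl | rfl | rfl | rfl <;> simp [quad] <;> omega

set_option maxHeartbeats 1600000 in
/-- **Connectors of different offsets in the same exterior square do not meet at interior points**
(the hug sets of the darts at the corners of one square — corner `L`s, side segments, concave
corners, three-side detours, as dictated by which sides are edges of `E` — are pairwise disjoint for
offsets `o ≠ o'` in `{1, 2, 3, 4}`; a finite check, by `omega`). [folklore] -/
theorem false_of_sameSquare {o o' : ℕ} (hoo' : o ≠ o') (ho0 : 0 < o) {ho : 2 * o ≤ 8}
    (ho0' : 0 < o') {ho' : 2 * o' ≤ 8} {x : Site 2} {k k' : Fin 4}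
    (hk : sideE (quad x k) k ∉ E) (hk' : sideE (quad x k) k' ∉ E)
    {w : Site 2} (hw : w ∈ (oconn E o ho (x, k)).support)
    (hw' : w ∈ (oconn E o' ho' (corner (quad x k) k', k')).support)
    (hint : w 0 % 8 ≠ 0 ∧ w 1 % 8 ≠ 0) : False := by
  obtain ⟨a, b, hwab, hs⟩ := mem_support_oconn_side hw
  obtain ⟨a', b', hwab', hs'⟩ := mem_support_oconn_side hw'
  rw [quad_corner] at hs'
  have e0 := congrFun hwab 0
  have e1 := congrFun hwab 1
  have e0' := congrFun hwab' 0
  have e1' := congrFun hwab' 1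
  obtain ⟨hi0, hi1⟩ := hint
  clear hw hw' hwab hwab'
  rcases fin_four_eq' k with rfl | rfl | rfl | rfl <;>
    rcases fin_four_eq' k' with rfl | rfl | rfl | rfl <;>
    simp only [Fin.reduceAdd] at hs hs' hk hk' e0 e1 e0' e1' <;>
    simp [quad, corner] at e0 e1 e0' e1' <;>
    rcases hs with ⟨h3, ⟨rfl, hb⟩ | ⟨rfl, ha⟩⟩ | ⟨h3, h2, rfl, hb⟩ |
        ⟨h3, h2, h1, ⟨rfl, hb⟩ | ⟨rfl, ha, ha2⟩⟩ |
        ⟨h3, h2, h1, ⟨rfl, hb⟩ | ⟨rfl, ha, ha2⟩ | ⟨rfl, hb⟩⟩ <;>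
    rcases hs' with ⟨h3', ⟨rfl, hb'⟩ | ⟨rfl, ha'⟩⟩ | ⟨h3', h2', rfl, hb'⟩ |
        ⟨h3', h2', h1', ⟨rfl, hb'⟩ | ⟨rfl, ha', ha2'⟩⟩ |
        ⟨h3', h2', h1', ⟨rfl, hb'⟩ | ⟨rfl, ha', ha2'⟩ | ⟨rfl, hb'⟩⟩ <;>
    first
    | contradiction
    | omega

/-- **Connector pieces of different offsets are vertex-disjoint** (`o ≠ o'`, both in `{1,…,4}`):
offset points lie on lattice lines with residues `±o ≠ ±o'`, interior points determine their
exterior square, and within one square `false_of_sameSquare` applies. [folklore] -/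
theorem oconn_support_disjoint {o o' : ℕ} (hoo' : o ≠ o') (ho0 : 0 < o) {ho : 2 * o ≤ 8}
    (ho0' : 0 < o') {ho' : 2 * o' ≤ 8} {d d' : Site 2 × Fin 4} (hd : IsExtDart E d)
    (hd' : IsExtDart E d') {w : Site 2} (hw : w ∈ (oconn E o ho d).support)
    (hw' : w ∈ (oconn E o' ho' d').support) : False := by
  obtain ⟨x, k⟩ := d
  obtain ⟨x', k'⟩ := d'
  have hne : ∀ e e' : Site 2 × Fin 4, opt o e ≠ opt o' e' := fun e e' ↦
    opt_ne_opt hoo' ho0 (by omega) ho0' (by omega) (by omega) e e'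
  -- an offset point of one piece is never a vertex of the other
  have key1 : ∀ e : Site 2 × Fin 4, w = opt o e → False := by
    intro e hwe
    rcases mem_support_oconn_cases ho0' hw' with h' | h' | ⟨a', b', hab', ha0', ha8', hb0', hb8'⟩
    · exact hne e _ (hwe.symm.trans h')
    · exact hne e _ (hwe.symm.trans h')
    · have h1 := mod_ne_zero_of_interior hab' ha0' ha8' hb0' hb8'
      have h2 := opt_mod_eq_zero o e
      rw [← hwe] at h2
      omega
  have key2 : ∀ e : Site 2 × Fin 4, w = opt o' e → False := by
    intro e hwe
    rcases mem_support_oconn_cases ho0 hw with h | h | ⟨a, b, hab, ha0, ha8, hb0, hb8⟩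
    · exact hne _ e (h.symm.trans hwe)
    · exact hne _ e (h.symm.trans hwe)
    · have h1 := mod_ne_zero_of_interior hab ha0 ha8 hb0 hb8
      have h2 := opt_mod_eq_zero o' e
      rw [← hwe] at h2
      omega
  rcases mem_support_oconn_cases ho0 hw with h | h | ⟨a, b, hab, ha0, ha8, hb0, hb8⟩
  · exact key1 _ h
  · exact key1 _ h
  rcases mem_support_oconn_cases ho0' hw' with h' | h' | ⟨a', b', hab', ha0', ha8', hb0', hb8'⟩
  · exact key2 _ h'
  · exact key2 _ h'
  -- both interior: same square
  have hq1 := ediv_eq_quad hab ha0 ha8 hb0 hb8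
  have hq2 := ediv_eq_quad hab' ha0' ha8' hb0' hb8'
  have hq : quad x k = quad x' k' :=
    Site.eq_iff_two.2 ⟨hq1.1.symm.trans hq2.1, hq1.2.symm.trans hq2.2⟩
  have hx' : x' = corner (quad x k) k' := by rw [hq, corner_quad]
  subst hx'
  refine false_of_sameSquare hoo' ho0 ho0' (k := k) (k' := k') ?_ ?_ hw hw'
    (mod_ne_zero_of_interior hab ha0 ha8 hb0 hb8)
  · rw [sideE_quad_self]; exact hd.2
  · rw [hq, sideE_quad_self]; exact hd'.2

end Sides

/-! ### The support of the offset boundary loop -/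

section LoopSupport

/-- The vertices of `oloop`: the start, or a vertex of one of its pieces. [folklore] -/
theorem mem_support_oloop {o : ℕ} {ho : 2 * o ≤ 8} {d : Site 2 × Fin 4} {M : ℕ} {w : Site 2}
    (hw : w ∈ (oloop E o ho d M).support) :
    w = opt o d ∨ ∃ j, j < M ∧ w ∈ (oconn E o ho ((succ E)^[j] d)).support := by
  induction M generalizing d with
  | zero =>
    left
    simpa [oloop] using hw
  | succ M ih =>
    change w ∈ ((oconn E o ho d).append (oloop E o ho (succ E d) M)).support at hw
    rw [Walk.mem_support_append_iff] at hw
    rcases hw with hw | hw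
    · exact Or.inr ⟨0, Nat.zero_lt_succ _, hw⟩
    · rcases ih hw with h | ⟨j, hj, h⟩
      · refine Or.inr ⟨0, Nat.zero_lt_succ _, ?_⟩
        rw [h]
        exact Walk.end_mem_support _
      · refine Or.inr ⟨j + 1, by omega, ?_⟩
        rwa [Function.iterate_succ_apply]

/-- The start of a piece is one of its vertices, so every vertex of `oloop` (including its start)
lies on some piece `oconn E o ho (succ^j d)`, `j < M`, as soon as `M > 0`. [folklore] -/
theorem mem_support_oloop' {o : ℕ} {ho : 2 * o ≤ 8} {d : Site 2 × Fin 4} {M : ℕ} (hM : 0 < M)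
    {w : Site 2} (hw : w ∈ (oloop E o ho d M).support) :
    ∃ j, j < M ∧ w ∈ (oconn E o ho ((succ E)^[j] d)).support := by
  rcases mem_support_oloop hw with rfl | h
  · exact ⟨0, hM, Walk.start_mem_support _⟩
  · exact h

/-- **Offset boundary loops of different offsets are vertex-disjoint.** [folklore] -/
theorem oloop_support_disjoint {o o' : ℕ} (hoo' : o ≠ o') (ho0 : 0 < o) {ho : 2 * o ≤ 8}
    (ho0' : 0 < o') {ho' : 2 * o' ≤ 8} {d d' : Site 2 × Fin 4} (hd : IsExtDart E d)
    (hd' : IsExtDart E d') {M M' : ℕ} (hM : 0 < M) (hM' : 0 < M') {w : Site 2}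
    (hw : w ∈ (oloop E o ho d M).support) (hw' : w ∈ (oloop E o' ho' d' M').support) : False := by
  obtain ⟨j, -, hj⟩ := mem_support_oloop' hM hw
  obtain ⟨j', -, hj'⟩ := mem_support_oloop' hM' hw'
  exact oconn_support_disjoint hoo' ho0 ho0' (hd.iterate j) (hd'.iterate j') hj hj'

end LoopSupport




/-! ### Refined images of lattice walks -/

section Refine

/-- The direction of a unit lattice step `u → v` (junk if `u, v` are not neighbours). [folklore] -/
def dirOf (u v : Site 2) : Fin 4 :=
  if v = u + dir 0 then 0 else if v = u + dir 1 then 1 else if v = u + dir 2 then 2 else 3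

/-- A lattice neighbour is reached by its direction. [folklore] -/
theorem add_dir_dirOf {u v : Site 2} (h : (zdGraph 2).Adj u v) : u + dir (dirOf u v) = v := by
  unfold dirOf
  split_ifs with h0 h1 h2
  · exact h0.symm
  · exact h1.symm
  · exact h2.symm
  · rcases stepKind_of_adj h with ⟨a, b⟩ | ⟨a, b⟩ | ⟨a, b⟩ | ⟨a, b⟩
    · exact absurd (Site.eq_iff_two.2 ⟨by simp; omega, by simp; omega⟩) h0
    · exact absurd (Site.eq_iff_two.2 ⟨by simp; omega, by simp; omega⟩) h2
    · exact absurd (Site.eq_iff_two.2 ⟨by simp; omega, by simp; omega⟩) h1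
    · exact Site.eq_iff_two.2 ⟨by simp; omega, by simp; omega⟩

/-- **The eightfold refinement of a lattice walk**: each unit step becomes a straight run of `8`
refined steps. [folklore] -/
def refine : {u v : Site 2} → (zdGraph 2).Walk u v → (zdGraph 2).Walk ((8 : ℤ) • u) ((8 : ℤ) • v)
  | _, _, Walk.nil => Walk.nil
  | u, _, @Walk.cons _ _ _ v _ h q =>
    ((run (dirOf u v) ((8 : ℤ) • u) 8).copy rfl (by
        rw [iterate_add_dir]
        push_cast
        rw [← smul_add, add_dir_dirOf h])).append (refine q)

/-- **Vertices of a refined walk**: refined lattice points `8z` of vertices `z` of the walk, or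
interior points `8y + t·e`, `0 < t < 8`, of its edges `{y, y + e}`. [folklore] -/
theorem mem_support_refine {u v w : Site 2} {p : (zdGraph 2).Walk u v} (hw : w ∈ (refine p).support) :
    (∃ z ∈ p.support, w = (8 : ℤ) • z) ∨
      ∃ y y' : Site 2, s(y, y') ∈ p.edges ∧ y + dir (dirOf y y') = y' ∧
        ∃ t : ℕ, 0 < t ∧ t < 8 ∧ w = (8 : ℤ) • y + (t : ℤ) • dir (dirOf y y') := by
  induction p with
  | nil =>
    left
    refine ⟨_, Walk.start_mem_support _, ?_⟩
    simpa [refine] using hw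
  | cons h q ih =>
    rename_i a b c
    change w ∈ (((run (dirOf a b) ((8 : ℤ) • a) 8).copy rfl _).append (refine q)).support at hw
    rw [Walk.mem_support_append_iff, Walk.support_copy] at hw
    rcases hw with hw | hw
    · obtain ⟨t, ht, rfl⟩ := mem_support_run.1 hw
      rcases Nat.eq_zero_or_pos t with rfl | ht0
      · exact Or.inl ⟨a, Walk.start_mem_support _, by simp⟩
      · rcases (show t < 8 ∨ t = 8 by omega) with ht8 | rfl
        · exact Or.inr ⟨a, b, by simp, add_dir_dirOf h, t, ht0, ht8, rfl⟩
        · refine Or.inl ⟨b, by simp, ?_⟩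
          conv_rhs => rw [← add_dir_dirOf h]
          push_cast
          rw [smul_add]
    · rcases ih hw with ⟨z, hz, rfl⟩ | ⟨y, y', he, hy, t, ht0, ht8, rfl⟩
      · exact Or.inl ⟨z, by simp [hz], rfl⟩
      · exact Or.inr ⟨y, y', by simp [he], hy, t, ht0, ht8, rfl⟩

/-- **Interior points determine their lattice edge**: if `8y + t·e_j = 8y' + t'·e_{j'}` with
`0 < t, t' < 8`, the two points describe the same unit edge from the same or from opposite ends.
[folklore] -/
theorem eq_or_rev_of_interior_eq {y y' : Site 2} {j j' : Fin 4} {t t' : ℕ} (ht0 : 0 < t)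
    (ht8 : t < 8) (ht0' : 0 < t') (ht8' : t' < 8)
    (h : (8 : ℤ) • y + (t : ℤ) • dir j = (8 : ℤ) • y' + (t' : ℤ) • dir j') :
    (y = y' ∧ j = j' ∧ t = t') ∨ (y' = y + dir j ∧ j' = j + 2 ∧ t + t' = 8) := by
  have h0 := congrFun h 0
  have h1 := congrFun h 1
  rcases fin_four_eq' j with rfl | rfl | rfl | rfl <;>
    rcases fin_four_eq' j' with rfl | rfl | rfl | rfl <;>
    simp [Site.eq_iff_two] at h0 h1 ⊢ <;> omega

/-- Interior points of the same undirected lattice edge. [folklore] -/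
theorem edge_eq_of_interior_eq {y y' : Site 2} {j j' : Fin 4} {t t' : ℕ} (ht0 : 0 < t)
    (ht8 : t < 8) (ht0' : 0 < t') (ht8' : t' < 8)
    (h : (8 : ℤ) • y + (t : ℤ) • dir j = (8 : ℤ) • y' + (t' : ℤ) • dir j') :
    s(y, y + dir j) = s(y', y' + dir j') := by
  rcases eq_or_rev_of_interior_eq ht0 ht8 ht0' ht8' h with ⟨rfl, rfl, -⟩ | ⟨rfl, rfl, -⟩
  · rfl
  · rw [add_assoc, (dir_add_dir_eq_zero_iff j (j + 2)).2 rfl, add_zero, Sym2.eq_swap]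

/-- A point `8y + t·e_j` (`0 ≤ t ≤ 8`) of a refined edge is a refined lattice point `8z` only at
its ends. [folklore] -/
theorem eq_ends_of_eq_smul {y z : Site 2} {j : Fin 4} {t : ℕ} (ht : t ≤ 8)
    (h : (8 : ℤ) • y + (t : ℤ) • dir j = (8 : ℤ) • z) : (t = 0 ∧ z = y) ∨ (t = 8 ∧ z = y + dir j) := by
  have h0 := congrFun h 0
  have h1 := congrFun h 1
  rcases fin_four_eq' j with rfl | rfl | rfl | rfl <;>
    simp [Site.eq_iff_two] at h0 h1 ⊢ <;> omega

/-- A point `8y + t·e_j` of a refined lattice edge has a refined coordinate `≡ 0 (mod 8)`: it is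
never strictly inside an exterior square. [folklore] -/
theorem mod_of_edge_point {y w : Site 2} {j : Fin 4} {t : ℕ}
    (h : w = (8 : ℤ) • y + (t : ℤ) • dir j) : w 0 % 8 = 0 ∨ w 1 % 8 = 0 := by
  subst h
  rcases fin_four_eq' j with rfl | rfl | rfl | rfl <;> simp

end Refine

/-! ### Winding numbers of closed walks: the jump across a horizontal edge -/

section ClosedWinding

variable {a c d : Site 2}

/-- For a closed lattice walk the boundary term across a horizontal edge vanishes. [folklore] -/
theorem walkWinding_sub_walkWinding_up_closed (p : (zdGraph 2).Walk a a) (u : Site 2) :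
    walkWinding p u - walkWinding p (u + Pi.single 1 1) =
      -(p.darts.map fun d ↦ hCross u d.fst d.snd).sum := by
  have := walkWinding_sub_walkWinding_up p u
  rw [sub_self, neg_zero, zero_sub] at this
  exact this

end ClosedWinding

/-! ### Edge-traversal counts of connector pieces at their ends -/

section PieceCross

/-- Traversal counts over a copied walk. [folklore] -/
theorem sum_map_darts_copy {G : SimpleGraph (Site 2)} {a b a' b' : Site 2} (p : G.Walk a b)
    (ha : a = a') (hb : b = b') (f : G.Dart → ℤ) :
    ((p.copy ha hb).darts.map f).sum = (p.darts.map f).sum := by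
  subst ha hb; rfl

/-- Traversal counts are additive under concatenation. [folklore] -/
theorem sum_map_darts_append {G : SimpleGraph (Site 2)} {a b c : Site 2} (p : G.Walk a b)
    (q : G.Walk b c) (f : G.Dart → ℤ) :
    (((p.append q).darts.map f).sum) = (p.darts.map f).sum + (q.darts.map f).sum := by
  rw [Walk.darts_append, List.map_append, List.sum_append]

/-- **The piece leaving an offset point**: among the darts of `oconn E o ho (x, k)`, the vertical
edge just above its start `m = opt o (x, k)` (base point `m - e₀`) is traversed (upwards, once) iff
`k = 0`. [folklore] -/
theorem sum_vCross_oconn_start {o : ℕ} (ho0 : 0 < o) (ho : 2 * o ≤ 8) (ho4 : 2 * o < 8)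
    (x : Site 2) (k : Fin 4) :
    ((oconn E o ho (x, k)).darts.map fun e ↦
        vCross (opt o (x, k) - Pi.single 0 1) e.fst e.snd).sum = if k = 0 then 1 else 0 := by
  unfold oconn
  dsimp only
  by_cases h1 : s(x, x + dir (k + 1)) ∉ E
  · rw [dif_pos h1, sum_map_darts_copy, sum_map_darts_append]
    rcases fin_four_eq' k with rfl | rfl | rfl | rfl
    · simp only [Fin.reduceAdd, sum_vCross_run_one, sum_vCross_run_two]
      simp [opt]
      omega
    · simp only [Fin.reduceAdd, sum_vCross_run_two, sum_vCross_run_three]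
      simp [iterate_add_dir, opt]
    · simp only [Fin.reduceAdd, sum_vCross_run_zero, sum_vCross_run_three]
      simp [opt]
    · simp only [Fin.reduceAdd, sum_vCross_run_zero, sum_vCross_run_one]
      simp [iterate_add_dir, opt]
  · rw [dif_neg h1]
    by_cases h2 : s(x + dir (k + 1), x + dir (k + 1) + dir k) ∉ E
    · rw [dif_pos h2, sum_map_darts_copy]
      rcases fin_four_eq' k with rfl | rfl | rfl | rfl
      · simp only [Fin.reduceAdd, sum_vCross_run_one]
        simp [opt]
      · simp only [Fin.reduceAdd, sum_vCross_run_two]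
        simp
      · simp only [Fin.reduceAdd, sum_vCross_run_three]
        simp [opt]
      · simp only [Fin.reduceAdd, sum_vCross_run_zero]
        simp
    · rw [dif_neg h2]
      by_cases h3 : s(x + dir (k + 1) + dir k, x + dir (k + 1) + dir k + dir (k - 1)) ∉ E
      · rw [dif_pos h3, sum_map_darts_copy, sum_map_darts_append]
        rcases fin_four_eq' k with rfl | rfl | rfl | rfl
        · simp only [Fin.reduceAdd, sum_vCross_run_zero, sum_vCross_run_one]
          simp [opt]
          omega
        · simp only [Fin.reduceAdd, sum_vCross_run_one, sum_vCross_run_two]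
          simp [iterate_add_dir, opt]
          omega
        · simp only [Fin.reduceAdd, sum_vCross_run_two, sum_vCross_run_three]
          simp [opt]
        · simp only [Fin.reduceAdd, sum_vCross_run_zero, sum_vCross_run_three]
          simp [iterate_add_dir, opt]
          omega
      · rw [dif_neg h3, sum_map_darts_copy, sum_map_darts_append, sum_map_darts_append]
        rcases fin_four_eq' k with rfl | rfl | rfl | rfl
        · simp only [Fin.reduceAdd, sum_vCross_run_zero, sum_vCross_run_one, sum_vCross_run_three]
          simp [iterate_add_dir, opt]
          split_ifs <;> omega
        · simp only [Fin.reduceAdd, sum_vCross_run_zero, sum_vCross_run_one, sum_vCross_run_two]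
          simp [iterate_add_dir, opt]
          omega
        · simp only [Fin.reduceAdd, sum_vCross_run_one, sum_vCross_run_two, sum_vCross_run_three]
          simp [iterate_add_dir, opt]
        · simp only [Fin.reduceAdd, sum_vCross_run_zero, sum_vCross_run_two, sum_vCross_run_three]
          simp [iterate_add_dir, opt]
          omega

/-- **The piece leaving an offset point**, horizontal edges: the horizontal edge just right of the
start `m` (base point `m - e₁`) is traversed (rightwards, once) iff `k = 3`. [folklore] -/
theorem sum_hCross_oconn_start {o : ℕ} (ho0 : 0 < o) (ho : 2 * o ≤ 8) (ho4 : 2 * o < 8)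
    (x : Site 2) (k : Fin 4) :
    ((oconn E o ho (x, k)).darts.map fun e ↦
        hCross (opt o (x, k) - Pi.single 1 1) e.fst e.snd).sum = if k = 3 then 1 else 0 := by
  unfold oconn
  dsimp only
  by_cases h1 : s(x, x + dir (k + 1)) ∉ E
  · rw [dif_pos h1, sum_map_darts_copy, sum_map_darts_append]
    rcases fin_four_eq' k with rfl | rfl | rfl | rfl
    · simp only [Fin.reduceAdd, sum_hCross_run_one, sum_hCross_run_two]
      simp [iterate_add_dir, opt]
    · simp only [Fin.reduceAdd, sum_hCross_run_two, sum_hCross_run_three]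
      simp [opt]
    · simp only [Fin.reduceAdd, sum_hCross_run_zero, sum_hCross_run_three]
      simp [iterate_add_dir, opt]
    · simp only [Fin.reduceAdd, sum_hCross_run_zero, sum_hCross_run_one]
      simp [opt]
      omega
  · rw [dif_neg h1]
    by_cases h2 : s(x + dir (k + 1), x + dir (k + 1) + dir k) ∉ E
    · rw [dif_pos h2, sum_map_darts_copy]
      rcases fin_four_eq' k with rfl | rfl | rfl | rfl
      · simp only [Fin.reduceAdd, sum_hCross_run_one]
        simp
      · simp only [Fin.reduceAdd, sum_hCross_run_two]
        simp [opt]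
      · simp only [Fin.reduceAdd, sum_hCross_run_three]
        simp
      · simp only [Fin.reduceAdd, sum_hCross_run_zero]
        simp [opt]
    · rw [dif_neg h2]
      by_cases h3 : s(x + dir (k + 1) + dir k, x + dir (k + 1) + dir k + dir (k - 1)) ∉ E
      · rw [dif_pos h3, sum_map_darts_copy, sum_map_darts_append]
        rcases fin_four_eq' k with rfl | rfl | rfl | rfl
        · simp only [Fin.reduceAdd, sum_hCross_run_zero, sum_hCross_run_one]
          simp [iterate_add_dir, opt]
          omega
        · simp only [Fin.reduceAdd, sum_hCross_run_one, sum_hCross_run_two]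
          simp [opt]
        · simp only [Fin.reduceAdd, sum_hCross_run_two, sum_hCross_run_three]
          simp [iterate_add_dir, opt]
          omega
        · simp only [Fin.reduceAdd, sum_hCross_run_zero, sum_hCross_run_three]
          simp [opt]
          omega
      · rw [dif_neg h3, sum_map_darts_copy, sum_map_darts_append, sum_map_darts_append]
        rcases fin_four_eq' k with rfl | rfl | rfl | rfl
        · simp only [Fin.reduceAdd, sum_hCross_run_zero, sum_hCross_run_one, sum_hCross_run_three]
          simp [iterate_add_dir, opt]
          omega
        · simp only [Fin.reduceAdd, sum_hCross_run_zero, sum_hCross_run_one, sum_hCross_run_two]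
          simp [iterate_add_dir, opt]
        · simp only [Fin.reduceAdd, sum_hCross_run_one, sum_hCross_run_two, sum_hCross_run_three]
          simp [iterate_add_dir, opt]
          omega
        · simp only [Fin.reduceAdd, sum_hCross_run_zero, sum_hCross_run_two, sum_hCross_run_three]
          simp [iterate_add_dir, opt]
          split_ifs <;> omega

/-- **The piece arriving at an offset point**: among the darts of `oconn E o ho (x, k)`, the
vertical edge just above its end `m' = opt o (succ E (x, k))` (base point `m' - e₀`) is traversed
(downwards, once) iff the successor dart points west. [folklore] -/
theorem sum_vCross_oconn_end {o : ℕ} (ho0 : 0 < o) (ho : 2 * o ≤ 8) (ho4 : 2 * o < 8)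
    (x : Site 2) (k : Fin 4) :
    ((oconn E o ho (x, k)).darts.map fun e ↦
        vCross (opt o (succ E (x, k)) - Pi.single 0 1) e.fst e.snd).sum =
      if (succ E (x, k)).2 = 2 then -1 else 0 := by
  unfold oconn
  dsimp only
  by_cases h1 : s(x, x + dir (k + 1)) ∉ E
  · rw [dif_pos h1, sum_map_darts_copy, sum_map_darts_append, succ_of_not_mem h1]
    rcases fin_four_eq' k with rfl | rfl | rfl | rfl
    · simp only [Fin.reduceAdd, sum_vCross_run_one, sum_vCross_run_two]
      simp [opt]
    · simp only [Fin.reduceAdd, sum_vCross_run_two, sum_vCross_run_three]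
      simp [iterate_add_dir, opt]
      omega
    · simp only [Fin.reduceAdd, sum_vCross_run_zero, sum_vCross_run_three]
      simp [opt]
    · simp only [Fin.reduceAdd, sum_vCross_run_zero, sum_vCross_run_one]
      simp [iterate_add_dir, opt]
  · rw [dif_neg h1]
    by_cases h2 : s(x + dir (k + 1), x + dir (k + 1) + dir k) ∉ E
    · rw [dif_pos h2, sum_map_darts_copy, succ_of_mem_of_not_mem h1 h2]
      rcases fin_four_eq' k with rfl | rfl | rfl | rfl
      · simp only [Fin.reduceAdd, sum_vCross_run_one]
        simp [opt]
      · simp only [Fin.reduceAdd, sum_vCross_run_two]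
        simp
      · simp only [Fin.reduceAdd, sum_vCross_run_three]
        simp [opt]
      · simp only [Fin.reduceAdd, sum_vCross_run_zero]
        simp
    · rw [dif_neg h2]
      by_cases h3 : s(x + dir (k + 1) + dir k, x + dir (k + 1) + dir k + dir (k - 1)) ∉ E
      · rw [dif_pos h3, sum_map_darts_copy, sum_map_darts_append,
          succ_of_mem_of_mem_of_not_mem h1 h2 h3]
        rcases fin_four_eq' k with rfl | rfl | rfl | rfl
        · simp only [Fin.reduceAdd, Fin.reduceSub, sum_vCross_run_zero, sum_vCross_run_one]
          simp [opt]
          omega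
        · simp only [Fin.reduceAdd, Fin.reduceSub, sum_vCross_run_one, sum_vCross_run_two]
          simp [iterate_add_dir, opt]
          omega
        · simp only [Fin.reduceAdd, Fin.reduceSub, sum_vCross_run_two, sum_vCross_run_three]
          simp [opt]
          omega
        · simp only [Fin.reduceAdd, Fin.reduceSub, sum_vCross_run_zero, sum_vCross_run_three]
          simp [iterate_add_dir, opt]
          omega
      · rw [dif_neg h3, sum_map_darts_copy, sum_map_darts_append, sum_map_darts_append,
          succ_of_mem_of_mem_of_mem h1 h2 h3]
        rcases fin_four_eq' k with rfl | rfl | rfl | rfl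
        · simp only [Fin.reduceAdd, sum_vCross_run_zero, sum_vCross_run_one, sum_vCross_run_three]
          simp [iterate_add_dir, opt]
          split_ifs <;> omega
        · simp only [Fin.reduceAdd, sum_vCross_run_zero, sum_vCross_run_one, sum_vCross_run_two]
          simp [iterate_add_dir, opt]
          omega
        · simp only [Fin.reduceAdd, sum_vCross_run_one, sum_vCross_run_two, sum_vCross_run_three]
          simp [iterate_add_dir, opt]
        · simp only [Fin.reduceAdd, sum_vCross_run_zero, sum_vCross_run_two, sum_vCross_run_three]
          simp [iterate_add_dir, opt]
          omega

/-- **The piece arriving at an offset point**, horizontal edges: the horizontal edge just right of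
the end `m'` (base point `m' - e₁`) is traversed (leftwards, once) iff the successor dart points
north. [folklore] -/
theorem sum_hCross_oconn_end {o : ℕ} (ho0 : 0 < o) (ho : 2 * o ≤ 8) (ho4 : 2 * o < 8)
    (x : Site 2) (k : Fin 4) :
    ((oconn E o ho (x, k)).darts.map fun e ↦
        hCross (opt o (succ E (x, k)) - Pi.single 1 1) e.fst e.snd).sum =
      if (succ E (x, k)).2 = 1 then -1 else 0 := by
  unfold oconn
  dsimp only
  by_cases h1 : s(x, x + dir (k + 1)) ∉ E
  · rw [dif_pos h1, sum_map_darts_copy, sum_map_darts_append, succ_of_not_mem h1]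
    rcases fin_four_eq' k with rfl | rfl | rfl | rfl
    · simp only [Fin.reduceAdd, sum_hCross_run_one, sum_hCross_run_two]
      simp [iterate_add_dir, opt]
      omega
    · simp only [Fin.reduceAdd, sum_hCross_run_two, sum_hCross_run_three]
      simp [opt]
    · simp only [Fin.reduceAdd, sum_hCross_run_zero, sum_hCross_run_three]
      simp [iterate_add_dir, opt]
    · simp only [Fin.reduceAdd, sum_hCross_run_zero, sum_hCross_run_one]
      simp [opt]
  · rw [dif_neg h1]
    by_cases h2 : s(x + dir (k + 1), x + dir (k + 1) + dir k) ∉ E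
    · rw [dif_pos h2, sum_map_darts_copy, succ_of_mem_of_not_mem h1 h2]
      rcases fin_four_eq' k with rfl | rfl | rfl | rfl
      · simp only [Fin.reduceAdd, sum_hCross_run_one]
        simp
      · simp only [Fin.reduceAdd, sum_hCross_run_two]
        simp [opt]
      · simp only [Fin.reduceAdd, sum_hCross_run_three]
        simp
      · simp only [Fin.reduceAdd, sum_hCross_run_zero]
        simp [opt]
    · rw [dif_neg h2]
      by_cases h3 : s(x + dir (k + 1) + dir k, x + dir (k + 1) + dir k + dir (k - 1)) ∉ E
      · rw [dif_pos h3, sum_map_darts_copy, sum_map_darts_append,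
          succ_of_mem_of_mem_of_not_mem h1 h2 h3]
        rcases fin_four_eq' k with rfl | rfl | rfl | rfl
        · simp only [Fin.reduceAdd, Fin.reduceSub, sum_hCross_run_zero, sum_hCross_run_one]
          simp [iterate_add_dir, opt]
          omega
        · simp only [Fin.reduceAdd, Fin.reduceSub, sum_hCross_run_one, sum_hCross_run_two]
          simp [opt]
          omega
        · simp only [Fin.reduceAdd, Fin.reduceSub, sum_hCross_run_two, sum_hCross_run_three]
          simp [iterate_add_dir, opt]
          omega
        · simp only [Fin.reduceAdd, Fin.reduceSub, sum_hCross_run_zero, sum_hCross_run_three]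
          simp [opt]
          omega
      · rw [dif_neg h3, sum_map_darts_copy, sum_map_darts_append, sum_map_darts_append,
          succ_of_mem_of_mem_of_mem h1 h2 h3]
        rcases fin_four_eq' k with rfl | rfl | rfl | rfl
        · simp only [Fin.reduceAdd, sum_hCross_run_zero, sum_hCross_run_one, sum_hCross_run_three]
          simp [iterate_add_dir, opt]
          omega
        · simp only [Fin.reduceAdd, sum_hCross_run_zero, sum_hCross_run_one, sum_hCross_run_two]
          simp [iterate_add_dir, opt]
        · simp only [Fin.reduceAdd, sum_hCross_run_one, sum_hCross_run_two, sum_hCross_run_three]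
          simp [iterate_add_dir, opt]
          omega
        · simp only [Fin.reduceAdd, sum_hCross_run_zero, sum_hCross_run_two, sum_hCross_run_three]
          simp [iterate_add_dir, opt]
          split_ifs <;> omega

/-- Traversal counts over the offset boundary loop are sums over its pieces. [folklore] -/
theorem sum_map_darts_oloop {o : ℕ} (ho : 2 * o ≤ 8) (d : Site 2 × Fin 4) (M : ℕ)
    (f : (zdGraph 2).Dart → ℤ) :
    ((oloop E o ho d M).darts.map f).sum =
      ∑ j ∈ Finset.range M, ((oconn E o ho ((succ E)^[j] d)).darts.map f).sum := by
  induction M generalizing d with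
  | zero => rfl
  | succ M ih =>
    change ((((oconn E o ho d).append (oloop E o ho (succ E d) M)).darts.map f).sum) = _
    rw [sum_map_darts_append, ih, Finset.sum_range_succ']
    simp only [Function.iterate_succ_apply, Function.iterate_zero, id_eq]
    ring

/-- A walk missing an endpoint of the vertical edge right of `u` does not traverse it. [folklore] -/
theorem sum_vCross_eq_zero_of_notMem {G : SimpleGraph (Site 2)} {a b : Site 2} (p : G.Walk a b)
    {u : Site 2}
    (h : u + Pi.single 0 1 ∉ p.support ∨ u + Pi.single 0 1 + Pi.single 1 1 ∉ p.support) :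
    (p.darts.map fun e ↦ vCross u e.fst e.snd).sum = 0 := by
  refine List.sum_eq_zero fun t ht ↦ ?_
  obtain ⟨e, he, rfl⟩ := List.mem_map.1 ht
  refine vCross_eq_zero_of_ne fun heq ↦ ?_
  have h1 : u + Pi.single 0 1 ∈ p.support := by
    have : u + Pi.single 0 1 ∈ s(e.fst, e.snd) := by rw [heq]; simp
    rcases Sym2.mem_iff.1 this with h' | h'
    · rw [h']; exact p.dart_fst_mem_support_of_mem_darts he
    · rw [h']; exact p.dart_snd_mem_support_of_mem_darts he
  have h2 : u + Pi.single 0 1 + Pi.single 1 1 ∈ p.support := by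
    have : u + Pi.single 0 1 + Pi.single 1 1 ∈ s(e.fst, e.snd) := by rw [heq]; simp
    rcases Sym2.mem_iff.1 this with h' | h'
    · rw [h']; exact p.dart_fst_mem_support_of_mem_darts he
    · rw [h']; exact p.dart_snd_mem_support_of_mem_darts he
  exact h.elim (fun h ↦ h h1) (fun h ↦ h h2)

/-- A walk missing an endpoint of the horizontal edge above `u` does not traverse it. [folklore] -/
theorem sum_hCross_eq_zero_of_notMem {G : SimpleGraph (Site 2)} {a b : Site 2} (p : G.Walk a b)
    {u : Site 2}
    (h : u + Pi.single 1 1 ∉ p.support ∨ u + Pi.single 1 1 + Pi.single 0 1 ∉ p.support) :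
    (p.darts.map fun e ↦ hCross u e.fst e.snd).sum = 0 := by
  refine List.sum_eq_zero fun t ht ↦ ?_
  obtain ⟨e, he, rfl⟩ := List.mem_map.1 ht
  refine hCross_eq_zero_of_ne fun heq ↦ ?_
  have h1 : u + Pi.single 1 1 ∈ p.support := by
    have : u + Pi.single 1 1 ∈ s(e.fst, e.snd) := by rw [heq]; simp
    rcases Sym2.mem_iff.1 this with h' | h'
    · rw [h']; exact p.dart_fst_mem_support_of_mem_darts he
    · rw [h']; exact p.dart_snd_mem_support_of_mem_darts he
  have h2 : u + Pi.single 1 1 + Pi.single 0 1 ∈ p.support := by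
    have : u + Pi.single 1 1 + Pi.single 0 1 ∈ s(e.fst, e.snd) := by rw [heq]; simp
    rcases Sym2.mem_iff.1 this with h' | h'
    · rw [h']; exact p.dart_fst_mem_support_of_mem_darts he
    · rw [h']; exact p.dart_snd_mem_support_of_mem_darts he
  exact h.elim (fun h ↦ h h1) (fun h ↦ h h2)

end PieceCross

/-! ### Spurs, positions along the cycle, edges of walks of `⟨E⟩` -/

section Helpers

variable {d₀ : Site 2 × Fin 4} {n : Fin 4 → ℕ}

/-- **The spur of a dart**: the refined walk from `8x` along the missing edge to the offset point
`opt o (x, k)`. [folklore] -/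
def spur (o : ℕ) (d : Site 2 × Fin 4) : (zdGraph 2).Walk ((8 : ℤ) • d.1) (opt o d) :=
  (run d.2 ((8 : ℤ) • d.1) o).copy rfl (by rw [iterate_add_dir]; rfl)

/-- The vertices of a spur. [folklore] -/
theorem mem_support_spur {o : ℕ} {d : Site 2 × Fin 4} {w : Site 2} :
    w ∈ (spur o d).support ↔ ∃ t : ℕ, t ≤ o ∧ w = (8 : ℤ) • d.1 + (t : ℤ) • dir d.2 := by
  rw [spur, Walk.support_copy, mem_support_run]

/-- Shifting a position by whole periods does not change the dart. [folklore] -/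
theorem IsRect.iterate_add_period (h : IsRect E d₀ n) (p : ℕ) :
    (succ E)^[p + (n 0 + n 1 + n 2 + n 3)] d₀ = (succ E)^[p] d₀ := by
  rw [Function.iterate_add_apply, h.periodic]

/-- **Positions along the boundary cycle**: two positions `p < 2N`, `q < N` carry the same dart iff
they agree modulo the period `N`. [folklore] -/
theorem IsRect.eq_or_eq_add_of_iterate_eq (h : IsRect E d₀ n) {p q : ℕ}
    (hp : p < (n 0 + n 1 + n 2 + n 3) + (n 0 + n 1 + n 2 + n 3)) (hq : q < n 0 + n 1 + n 2 + n 3)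
    (heq : (succ E)^[p] d₀ = (succ E)^[q] d₀) : p = q ∨ p = q + (n 0 + n 1 + n 2 + n 3) := by
  set N := n 0 + n 1 + n 2 + n 3 with hN
  by_cases hpN : p < N
  · exact Or.inl (h.injOn p q hpN hq heq)
  · right
    have hp' : p - N < N := by omega
    have e := h.iterate_add_period (p - N)
    rw [← hN, Nat.sub_add_cancel (not_lt.1 hpN)] at e
    have := h.injOn _ _ hp' hq (e.symm.trans heq)
    omega

/-- `⟨E⟩` is a subgraph of `ℤ²` for a presented rectangle. [folklore] -/
theorem IsRect.fromEdgeSet_le (h : IsRect E d₀ n) :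
    fromEdgeSet (↑E : Set (Sym2 (Site 2))) ≤ zdGraph 2 := by
  intro u v huv
  rw [fromEdgeSet_adj, Finset.mem_coe] at huv
  exact (SimpleGraph.mem_edgeSet (G := zdGraph 2)).1 (h.subset_edgeSet _ huv.1)

/-- Edges of a walk of `⟨E⟩` are edges of `E`. [folklore] -/
theorem mem_of_mem_edges {u v : Site 2} (P : (fromEdgeSet (↑E : Set (Sym2 (Site 2)))).Walk u v)
    {e : Sym2 (Site 2)} (he : e ∈ P.edges) : e ∈ E := by
  have := P.edges_subset_edgeSet he
  rw [SimpleGraph.edgeSet_fromEdgeSet] at this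
  exact Finset.mem_coe.1 this.1

/-- Refined lattice points determine the lattice point. [folklore] -/
theorem eq_of_smul_eight_eq {y y' : Site 2} (h : (8 : ℤ) • y = (8 : ℤ) • y') : y = y' := by
  have h0 := congrFun h 0
  have h1 := congrFun h 1
  simp only [Pi.smul_apply, smul_eq_mul] at h0 h1
  exact Site.eq_iff_two.2 ⟨by omega, by omega⟩

/-- A refined lattice point has both coordinates `≡ 0 (mod 8)`. [folklore] -/
theorem smul_eight_mod (y : Site 2) : ((8 : ℤ) • y) 0 % 8 = 0 ∧ ((8 : ℤ) • y) 1 % 8 = 0 := by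
  simp

end Helpers



/-! ### Reversal of traversal counts -/

section Reverse

/-- `vCross` is antisymmetric in the step. [folklore] -/
theorem vCross_swap (u x y : Site 2) : vCross u y x = -vCross u x y := by
  unfold vCross; ring

/-- `hCross` is antisymmetric in the step. [folklore] -/
theorem hCross_swap (u x y : Site 2) : hCross u y x = -hCross u x y := by
  unfold hCross; ring

/-- Antisymmetric traversal counts change sign under reversal of the walk. [folklore] -/
theorem sum_map_darts_reverse_of_antisymm {G : SimpleGraph (Site 2)} {a b : Site 2}
    (p : G.Walk a b) (g : Site 2 → Site 2 → ℤ) (hg : ∀ x y, g y x = -g x y) :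
    (p.reverse.darts.map fun e ↦ g e.fst e.snd).sum = -(p.darts.map fun e ↦ g e.fst e.snd).sum := by
  induction p with
  | nil => simp
  | cons h q ih =>
    rename_i a' b' c'
    rw [Walk.reverse_cons, Walk.darts_append, List.map_append, List.sum_append, ih,
      Walk.darts_cons, List.map_cons, List.sum_cons]
    simp only [Walk.darts_cons, Walk.darts_nil, List.map_cons, List.map_nil, List.sum_cons,
      List.sum_nil, add_zero]
    rw [hg a' b']
    ring

end Reverse

/-! ### The separation lemma -/

section Separation

variable {d₀ : Site 2 × Fin 4} {n : Fin 4 → ℕ}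

set_option maxHeartbeats 800000 in
/-- **Separation lemma for discrete topological rectangles** (the discrete Jordan-curve fact used
throughout CDH16 §4, "topologically, [the crossing] must intersect any crossing from `(a₂a₃)` to
`(b₁b₂)`"): in a presented rectangle `IsRect E d₀ n`, every walk of `⟨E⟩` from the base vertex of a
dart of arc `0` to the base vertex of a dart of arc `2` has a common vertex with every walk of
`⟨E⟩` from (the base of a dart of) arc `1` to arc `3`.

Proof (intersection number): close the first walk `P₁`, refined eightfold, through the offset-`2`
boundary loop from arc `2` round arc `3` to arc `0` (a closed refined walk `W`), and follow the
second walk `P₂`, refined, from arc `1` to arc `3`, then its spur out to offset `3`, the offset-`3`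
loop round arc `0` back to arc `1`, and the spur in. If `P₁`, `P₂` were disjoint, `W` would avoid all
of this closed itinerary except the one crossing of the spur at arc `3` with the offset-`2` loop,
where the winding number of `W` jumps by `-1` (`sum_vCross_oconn_start/end`,
`sum_hCross_oconn_start/end`); summing the jumps round the closed itinerary gives `0 = -1`.
[cite: ChelkakDuminilCopinHongler2016, §2.1 and §4 (planarity of discrete domains)] -/
theorem IsRect.exists_mem_support_inter (h : IsRect E d₀ n) {ia ib ic id : ℕ}
    (hia : ia < n 0) (hib1 : n 0 ≤ ib) (hib2 : ib < n 0 + n 1) (hic1 : n 0 + n 1 ≤ ic)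
    (hic2 : ic < n 0 + n 1 + n 2) (hid1 : n 0 + n 1 + n 2 ≤ id)
    (hid2 : id < n 0 + n 1 + n 2 + n 3)
    (P₁ : (fromEdgeSet (↑E : Set (Sym2 (Site 2)))).Walk ((succ E)^[ia] d₀).1 ((succ E)^[ic] d₀).1)
    (P₂ : (fromEdgeSet (↑E : Set (Sym2 (Site 2)))).Walk ((succ E)^[ib] d₀).1 ((succ E)^[id] d₀).1) :
    ∃ z ∈ P₁.support, z ∈ P₂.support := by
  by_contra hcon
  push Not at hcon
  have hN3 : 0 < n 3 := h.pos 3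
  set N := n 0 + n 1 + n 2 + n 3 with hN
  -- name the four darts
  generalize hda : (succ E)^[ia] d₀ = da at P₁
  generalize hdb : (succ E)^[ib] d₀ = db at P₂
  generalize hdc : (succ E)^[ic] d₀ = dc at P₁
  generalize hdd : (succ E)^[id] d₀ = dd at P₂
  have hda' : IsExtDart E da := hda ▸ h.isExtDart.iterate ia
  have hdb' : IsExtDart E db := hdb ▸ h.isExtDart.iterate ib
  have hdc' : IsExtDart E dc := hdc ▸ h.isExtDart.iterate ic
  have hdd' : IsExtDart E dd := hdd ▸ h.isExtDart.iterate id
  have hbc : db ≠ dc := fun heq ↦ by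
    have := h.injOn ib ic (by omega) (by omega) (hdb.trans (heq.trans hdc.symm)); omega
  have hba : db ≠ da := fun heq ↦ by
    have := h.injOn ib ia (by omega) (by omega) (hdb.trans (heq.trans hda.symm)); omega
  have hdcne : dd ≠ dc := fun heq ↦ by
    have := h.injOn id ic (by omega) (by omega) (hdd.trans (heq.trans hdc.symm)); omega
  have hdane : dd ≠ da := fun heq ↦ by
    have := h.injOn id ia (by omega) (by omega) (hdd.trans (heq.trans hda.symm)); omega
  have ha1 : da.1 ∈ P₁.support := P₁.start_mem_support
  have hc1 : dc.1 ∈ P₁.support := P₁.end_mem_support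
  have hb2 : db.1 ∈ P₂.support := P₂.start_mem_support
  have hd2 : dd.1 ∈ P₂.support := P₂.end_mem_support
  have ho2 : 2 * 2 ≤ 8 := by norm_num
  have ho3 : 2 * 3 ≤ 8 := by norm_num
  have hle := h.fromEdgeSet_le
  -- the two loop segments
  have hMw : 0 < N - ic + ia := by omega
  have hendW : (succ E)^[N - ic + ia] dc = da := by
    rw [← hdc, ← Function.iterate_add_apply, show N - ic + ia + ic = ia + N by omega,
      hN, h.iterate_add_period, hda]
  have hMv : 0 < N - id + ib := by omega
  have hendV : (succ E)^[N - id + ib] dd = db := by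
    rw [← hdd, ← Function.iterate_add_apply, show N - id + ib + id = ib + N by omega,
      hN, h.iterate_add_period, hdb]
  -- pieces of the loop from `dc`: which positions they occupy
  have hpos : ∀ j, j ≤ N - ic + ia → ∀ q, q < N → (succ E)^[j] dc = (succ E)^[q] d₀ →
      j + ic = q ∨ j + ic = q + N := by
    intro j hj q hq heq
    rw [← hdc, ← Function.iterate_add_apply] at heq
    exact h.eq_or_eq_add_of_iterate_eq (by omega) hq heq
  -- the closed walk `W`
  set R₁ := refine (P₁.mapLe hle) with hR₁
  set R₂ := refine (P₂.mapLe hle) with hR₂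
  set Lw := (oloop E 2 ho2 dc (N - ic + ia)).copy rfl (congrArg (opt 2) hendW) with hLw
  set Lv := (oloop E 3 ho3 dd (N - id + ib)).copy rfl (congrArg (opt 3) hendV) with hLv
  set W := (((spur 2 dc).append Lw).append (spur 2 da).reverse).append R₁ with hW
  have memW : ∀ z ∈ W.support, z ∈ (spur 2 dc).support ∨
      z ∈ (oloop E 2 ho2 dc (N - ic + ia)).support ∨ z ∈ (spur 2 da).support ∨ z ∈ R₁.support := by
    intro z hz
    simp only [hW, hLw, Walk.mem_support_append_iff, Walk.support_reverse, List.mem_reverse,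
      Walk.support_copy] at hz
    tauto
  have hP₁E : ∀ {y y' : Site 2}, s(y, y') ∈ (P₁.mapLe hle).edges → s(y, y') ∈ E := by
    intro y y' he
    rw [Walk.edges_mapLe_eq_edges] at he
    exact mem_of_mem_edges P₁ he
  have hP₁s : ∀ {y y' : Site 2}, s(y, y') ∈ (P₁.mapLe hle).edges →
      y ∈ P₁.support ∧ y' ∈ P₁.support := by
    intro y y' he
    refine ⟨?_, ?_⟩
    · have := Walk.fst_mem_support_of_mem_edges _ he; rwa [Walk.support_mapLe_eq_support] at this
    · have := Walk.snd_mem_support_of_mem_edges _ he; rwa [Walk.support_mapLe_eq_support] at this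
  ------------------------------------------------------------------
  -- (X1) refined lattice points of vertices of `P₂` are off `W`
  have hX1 : ∀ y ∈ P₂.support, (8 : ℤ) • y ∉ W.support := by
    intro y hy hyW
    rcases memW _ hyW with h1 | h2 | h3 | h4
    · obtain ⟨t, ht, he⟩ := mem_support_spur.1 h1
      rcases eq_ends_of_eq_smul (by omega) he.symm with ⟨-, rfl⟩ | ⟨h8, -⟩
      · exact hcon _ hc1 hy
      · omega
    · obtain ⟨j, hj, hz⟩ := mem_support_oloop' hMw h2
      generalize (succ E)^[j] dc = e at hz
      obtain ⟨x, k⟩ := e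
      rcases mem_support_oconn_cases (by norm_num) hz with he | he | ⟨a, b, hab, ha0, ha8, hb0, hb8⟩
      · rcases eq_ends_of_eq_smul (t := 2) (by norm_num) he.symm with ⟨h0, -⟩ | ⟨h8, -⟩ <;> omega
      · rcases eq_ends_of_eq_smul (t := 2) (by norm_num) he.symm with ⟨h0, -⟩ | ⟨h8, -⟩ <;> omega
      · have h1 := mod_ne_zero_of_interior hab ha0 ha8 hb0 hb8
        have h2 := smul_eight_mod y
        omega
    · obtain ⟨t, ht, he⟩ := mem_support_spur.1 h3
      rcases eq_ends_of_eq_smul (by omega) he.symm with ⟨-, rfl⟩ | ⟨h8, -⟩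
      · exact hcon _ ha1 hy
      · omega
    · rcases mem_support_refine h4 with ⟨z', hz', he⟩ | ⟨y₁, y₁', he₁, -, t, ht0, ht8, he⟩
      · have := eq_of_smul_eight_eq he
        subst this
        rw [Walk.support_mapLe_eq_support] at hz'
        exact hcon _ hz' hy
      · rcases eq_ends_of_eq_smul (by omega) he.symm with ⟨h0, -⟩ | ⟨h8, -⟩ <;> omega
  -- (X2) interior points of edges of `E` with endpoints on `P₂` are off `W`
  have hX2 : ∀ (y : Site 2) (j : Fin 4) (t : ℕ), 0 < t → t < 8 → y ∈ P₂.support →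
      y + dir j ∈ P₂.support → s(y, y + dir j) ∈ E →
      (8 : ℤ) • y + (t : ℤ) • dir j ∉ W.support := by
    intro y j t ht0 ht8 hy hy' hyE hzW
    rcases memW _ hzW with h1 | h2 | h3 | h4
    · obtain ⟨t', ht', he⟩ := mem_support_spur.1 h1
      rcases Nat.eq_zero_or_pos t' with rfl | ht'0
      · simp only [Nat.cast_zero, zero_smul, add_zero] at he
        rcases eq_ends_of_eq_smul ht8.le he with ⟨h0, -⟩ | ⟨h8, -⟩ <;> omega
      · exact hdc'.2 (edge_eq_of_interior_eq ht0 ht8 ht'0 (by omega) he ▸ hyE)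
    · obtain ⟨j', hj', hz⟩ := mem_support_oloop' hMw h2
      have hext : IsExtDart E ((succ E)^[j'] dc) := hdc'.iterate j'
      generalize (succ E)^[j'] dc = e at hz hext
      obtain ⟨x, k⟩ := e
      rcases mem_support_oconn_cases (by norm_num) hz with he | he | ⟨a, b, hab, ha0, ha8, hb0, hb8⟩
      · exact hext.2 (edge_eq_of_interior_eq ht0 ht8 (t' := 2) (by norm_num) (by norm_num) he ▸ hyE)
      · exact hext.succ.2
          (edge_eq_of_interior_eq ht0 ht8 (t' := 2) (by norm_num) (by norm_num) he ▸ hyE)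
      · have h1 := mod_ne_zero_of_interior hab ha0 ha8 hb0 hb8
        have h2 := mod_of_edge_point (rfl : (8 : ℤ) • y + (t : ℤ) • dir j = _)
        omega
    · obtain ⟨t', ht', he⟩ := mem_support_spur.1 h3
      rcases Nat.eq_zero_or_pos t' with rfl | ht'0
      · simp only [Nat.cast_zero, zero_smul, add_zero] at he
        rcases eq_ends_of_eq_smul ht8.le he with ⟨h0, -⟩ | ⟨h8, -⟩ <;> omega
      · exact hda'.2 (edge_eq_of_interior_eq ht0 ht8 ht'0 (by omega) he ▸ hyE)
    · rcases mem_support_refine h4 with ⟨z', hz', he⟩ | ⟨y₁, y₁', he₁, hy₁, t', ht0', ht8', he⟩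
      · rcases eq_ends_of_eq_smul ht8.le he with ⟨h0, -⟩ | ⟨h8, -⟩ <;> omega
      · obtain ⟨hy₁s, hy₁'s⟩ := hP₁s he₁
        rcases eq_or_rev_of_interior_eq ht0 ht8 ht0' ht8' he with ⟨rfl, -, -⟩ | ⟨h₁, -, -⟩
        · exact hcon _ hy₁s hy
        · exact hcon _ hy₁s (h₁ ▸ hy')
  -- (X3) spur points of darts other than `dc, da`, off the offset `2`, are off `W`
  have hX3 : ∀ e : Site 2 × Fin 4, IsExtDart E e → e ≠ dc → e ≠ da → ∀ t : ℕ, 0 < t → t ≤ 3 →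
      t ≠ 2 → (8 : ℤ) • e.1 + (t : ℤ) • dir e.2 ∉ W.support := by
    intro e he hec hea t ht0 ht3 ht2 hzW
    rcases memW _ hzW with h1 | h2 | h3 | h4
    · obtain ⟨t', ht', he'⟩ := mem_support_spur.1 h1
      rcases Nat.eq_zero_or_pos t' with rfl | ht'0
      · simp only [Nat.cast_zero, zero_smul, add_zero] at he'
        rcases eq_ends_of_eq_smul (by omega) he' with ⟨h0, -⟩ | ⟨h8, -⟩ <;> omega
      · rcases eq_or_rev_of_interior_eq ht0 (by omega) ht'0 (by omega) he' with
          ⟨h₁, h₂, -⟩ | ⟨-, -, h₃⟩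
        · exact hec (Prod.ext h₁ h₂)
        · omega
    · obtain ⟨j', hj', hz⟩ := mem_support_oloop' hMw h2
      generalize (succ E)^[j'] dc = e' at hz
      obtain ⟨x, k⟩ := e'
      rcases mem_support_oconn_cases (by norm_num) hz with he' | he' | ⟨a, b, hab, ha0, ha8, hb0, hb8⟩
      · rcases eq_or_rev_of_interior_eq ht0 (by omega) (t' := 2) (by norm_num) (by norm_num) he'
          with ⟨-, -, h₃⟩ | ⟨-, -, h₃⟩ <;> omega
      · rcases eq_or_rev_of_interior_eq ht0 (by omega) (t' := 2) (by norm_num) (by norm_num) he'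
          with ⟨-, -, h₃⟩ | ⟨-, -, h₃⟩ <;> omega
      · have h1 := mod_ne_zero_of_interior hab ha0 ha8 hb0 hb8
        have h2 := mod_of_edge_point (rfl : (8 : ℤ) • e.1 + (t : ℤ) • dir e.2 = _)
        omega
    · obtain ⟨t', ht', he'⟩ := mem_support_spur.1 h3
      rcases Nat.eq_zero_or_pos t' with rfl | ht'0
      · simp only [Nat.cast_zero, zero_smul, add_zero] at he'
        rcases eq_ends_of_eq_smul (by omega) he' with ⟨h0, -⟩ | ⟨h8, -⟩ <;> omega
      · rcases eq_or_rev_of_interior_eq ht0 (by omega) ht'0 (by omega) he' with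
          ⟨h₁, h₂, -⟩ | ⟨-, -, h₃⟩
        · exact hea (Prod.ext h₁ h₂)
        · omega
    · rcases mem_support_refine h4 with ⟨z', hz', he'⟩ | ⟨y₁, y₁', he₁, hy₁, t', ht0', ht8', he'⟩
      · rcases eq_ends_of_eq_smul (by omega) he' with ⟨h0, -⟩ | ⟨h8, -⟩ <;> omega
      · refine he.2 ?_
        rw [edge_eq_of_interior_eq ht0 (by omega) ht0' ht8' he', hy₁]
        exact hP₁E he₁
  -- (X4) the offset-`2` point of `db` is off `W`
  have hX4 : opt 2 db ∉ W.support := by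
    intro hzW
    rcases memW _ hzW with h1 | h2 | h3 | h4
    · obtain ⟨t', ht', he'⟩ := mem_support_spur.1 h1
      rcases Nat.eq_zero_or_pos t' with rfl | ht'0
      · simp only [Nat.cast_zero, zero_smul, add_zero] at he'
        rcases eq_ends_of_eq_smul (t := 2) (by omega) he' with ⟨h0, -⟩ | ⟨h8, -⟩ <;> omega
      · rcases eq_or_rev_of_interior_eq (t := 2) (by norm_num) (by norm_num) ht'0 (by omega) he'
          with ⟨h₁, h₂, -⟩ | ⟨-, -, h₃⟩
        · exact hbc (Prod.ext h₁ h₂)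
        · omega
    · obtain ⟨j', hj', hz⟩ := mem_support_oloop' hMw h2
      have hp1 := hpos j' hj'.le ib (by omega)
      have hp2 := hpos (j' + 1) hj' ib (by omega)
      rw [Function.iterate_succ_apply'] at hp2
      generalize (succ E)^[j'] dc = e' at hz hp1 hp2
      obtain ⟨x, k⟩ := e'
      rcases mem_support_oconn_cases (by norm_num) hz with he' | he' | ⟨a, b, hab, ha0, ha8, hb0, hb8⟩
      · have := opt_injective (by norm_num) (by norm_num) he'
        rcases hp1 (this ▸ hdb.symm) with h' | h' <;> omega
      · have := opt_injective (by norm_num) (by norm_num) he'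
        rcases hp2 (this ▸ hdb.symm) with h' | h' <;> omega
      · have h1 := mod_ne_zero_of_interior hab ha0 ha8 hb0 hb8
        have h2 := opt_mod_eq_zero 2 db
        omega
    · obtain ⟨t', ht', he'⟩ := mem_support_spur.1 h3
      rcases Nat.eq_zero_or_pos t' with rfl | ht'0
      · simp only [Nat.cast_zero, zero_smul, add_zero] at he'
        rcases eq_ends_of_eq_smul (t := 2) (by omega) he' with ⟨h0, -⟩ | ⟨h8, -⟩ <;> omega
      · rcases eq_or_rev_of_interior_eq (t := 2) (by norm_num) (by norm_num) ht'0 (by omega) he'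
          with ⟨h₁, h₂, -⟩ | ⟨-, -, h₃⟩
        · exact hba (Prod.ext h₁ h₂)
        · omega
    · rcases mem_support_refine h4 with ⟨z', hz', he'⟩ | ⟨y₁, y₁', he₁, hy₁, t', ht0', ht8', he'⟩
      · rcases eq_ends_of_eq_smul (t := 2) (by omega) he' with ⟨h0, -⟩ | ⟨h8, -⟩ <;> omega
      · refine hdb'.2 ?_
        rw [show s(db.1, db.1 + dir db.2) = s(y₁, y₁ + dir (dirOf y₁ y₁')) from
          edge_eq_of_interior_eq (t := 2) (by norm_num) (by norm_num) ht0' ht8' he', hy₁]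
        exact hP₁E he₁
  -- (X5) the offset-`3` loop from `dd` is off `W`
  have hX5 : ∀ z ∈ (oloop E 3 ho3 dd (N - id + ib)).support, z ∉ W.support := by
    intro z hz hzW
    obtain ⟨j, hj, hzj⟩ := mem_support_oloop' hMv hz
    have hext : IsExtDart E ((succ E)^[j] dd) := hdd'.iterate j
    rcases memW _ hzW with h1 | h2 | h3 | h4
    · obtain ⟨t', ht', he'⟩ := mem_support_spur.1 h1
      generalize (succ E)^[j] dd = e' at hzj hext
      obtain ⟨x, k⟩ := e'
      rcases mem_support_oconn_cases (by norm_num) hzj with he | he | ⟨a, b, hab, ha0, ha8, hb0, hb8⟩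
      · rw [he] at he'
        rcases Nat.eq_zero_or_pos t' with rfl | ht'0
        · simp only [Nat.cast_zero, zero_smul, add_zero] at he'
          rcases eq_ends_of_eq_smul (t := 3) (by omega) he' with ⟨h0, -⟩ | ⟨h8, -⟩ <;> omega
        · rcases eq_or_rev_of_interior_eq (t := 3) (by norm_num) (by norm_num) ht'0 (by omega) he'
            with ⟨-, -, h₃⟩ | ⟨-, -, h₃⟩ <;> omega
      · rw [he] at he'
        rcases Nat.eq_zero_or_pos t' with rfl | ht'0
        · simp only [Nat.cast_zero, zero_smul, add_zero] at he'
          rcases eq_ends_of_eq_smul (t := 3) (by omega) he' with ⟨h0, -⟩ | ⟨h8, -⟩ <;> omega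
        · rcases eq_or_rev_of_interior_eq (t := 3) (by norm_num) (by norm_num) ht'0 (by omega) he'
            with ⟨-, -, h₃⟩ | ⟨-, -, h₃⟩ <;> omega
      · have h1 := mod_ne_zero_of_interior hab ha0 ha8 hb0 hb8
        rcases Nat.eq_zero_or_pos t' with rfl | ht'0
        · simp only [Nat.cast_zero, zero_smul, add_zero] at he'
          have h2 := smul_eight_mod dc.1
          rw [← he'] at h2
          omega
        · have h2 := mod_of_edge_point he'
          omega
    · exact oloop_support_disjoint (by norm_num) (by norm_num) (by norm_num) hdd' hdc' hMv hMw hz h2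
    · obtain ⟨t', ht', he'⟩ := mem_support_spur.1 h3
      generalize (succ E)^[j] dd = e' at hzj hext
      obtain ⟨x, k⟩ := e'
      rcases mem_support_oconn_cases (by norm_num) hzj with he | he | ⟨a, b, hab, ha0, ha8, hb0, hb8⟩
      · rw [he] at he'
        rcases Nat.eq_zero_or_pos t' with rfl | ht'0
        · simp only [Nat.cast_zero, zero_smul, add_zero] at he'
          rcases eq_ends_of_eq_smul (t := 3) (by omega) he' with ⟨h0, -⟩ | ⟨h8, -⟩ <;> omega
        · rcases eq_or_rev_of_interior_eq (t := 3) (by norm_num) (by norm_num) ht'0 (by omega) he'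
            with ⟨-, -, h₃⟩ | ⟨-, -, h₃⟩ <;> omega
      · rw [he] at he'
        rcases Nat.eq_zero_or_pos t' with rfl | ht'0
        · simp only [Nat.cast_zero, zero_smul, add_zero] at he'
          rcases eq_ends_of_eq_smul (t := 3) (by omega) he' with ⟨h0, -⟩ | ⟨h8, -⟩ <;> omega
        · rcases eq_or_rev_of_interior_eq (t := 3) (by norm_num) (by norm_num) ht'0 (by omega) he'
            with ⟨-, -, h₃⟩ | ⟨-, -, h₃⟩ <;> omega
      · have h1 := mod_ne_zero_of_interior hab ha0 ha8 hb0 hb8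
        rcases Nat.eq_zero_or_pos t' with rfl | ht'0
        · simp only [Nat.cast_zero, zero_smul, add_zero] at he'
          have h2 := smul_eight_mod da.1
          rw [← he'] at h2
          omega
        · have h2 := mod_of_edge_point he'
          omega
    · generalize (succ E)^[j] dd = e' at hzj hext
      obtain ⟨x, k⟩ := e'
      rcases mem_support_refine h4 with ⟨z', hz', he'⟩ | ⟨y₁, y₁', he₁, hy₁, t', ht0', ht8', he'⟩
      · rcases mem_support_oconn_cases (by norm_num) hzj with he | he | ⟨a, b, hab, ha0, ha8, hb0, hb8⟩
        · rw [he] at he'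
          rcases eq_ends_of_eq_smul (t := 3) (by omega) he' with ⟨h0, -⟩ | ⟨h8, -⟩ <;> omega
        · rw [he] at he'
          rcases eq_ends_of_eq_smul (t := 3) (by omega) he' with ⟨h0, -⟩ | ⟨h8, -⟩ <;> omega
        · have h1 := mod_ne_zero_of_interior hab ha0 ha8 hb0 hb8
          have h2 := smul_eight_mod z'
          rw [← he'] at h2
          omega
      · rcases mem_support_oconn_cases (by norm_num) hzj with he | he | ⟨a, b, hab, ha0, ha8, hb0, hb8⟩
        · rw [he] at he'
          refine hext.2 ?_
          rw [show s(x, x + dir k) = s(y₁, y₁ + dir (dirOf y₁ y₁')) from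
            edge_eq_of_interior_eq (t := 3) (by norm_num) (by norm_num) ht0' ht8' he', hy₁]
          exact hP₁E he₁
        · rw [he] at he'
          refine hext.succ.2 ?_
          rw [show s((succ E (x, k)).1, (succ E (x, k)).1 + dir (succ E (x, k)).2) =
              s(y₁, y₁ + dir (dirOf y₁ y₁')) from
            edge_eq_of_interior_eq (t := 3) (by norm_num) (by norm_num) ht0' ht8' he', hy₁]
          exact hP₁E he₁
        · have h1 := mod_ne_zero_of_interior hab ha0 ha8 hb0 hb8
          have h2 := mod_of_edge_point he'
          omega
  ------------------------------------------------------------------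
  -- the three zero brackets
  have hB1 : walkWinding W ((8 : ℤ) • db.1) = walkWinding W ((8 : ℤ) • dd.1) := by
    refine WeakBeurling.walkWinding_closed_eq_of_walk W R₂ fun z hz ↦ ?_
    rcases mem_support_refine hz with ⟨y, hy, rfl⟩ | ⟨y, y', he, hy', t, ht0, ht8, rfl⟩
    · rw [Walk.support_mapLe_eq_support] at hy
      exact hX1 y hy
    · have hyE : s(y, y') ∈ E := by
        rw [Walk.edges_mapLe_eq_edges] at he; exact mem_of_mem_edges P₂ he
      have hys : y ∈ P₂.support := by
        have := Walk.fst_mem_support_of_mem_edges _ he; rwa [Walk.support_mapLe_eq_support] at this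
      have hy's : y' ∈ P₂.support := by
        have := Walk.snd_mem_support_of_mem_edges _ he; rwa [Walk.support_mapLe_eq_support] at this
      rw [← hy'] at hyE hy's
      exact hX2 y _ t ht0 ht8 hys hy's hyE
  have hB3 : walkWinding W (opt 3 dd) = walkWinding W (opt 3 db) := by
    refine WeakBeurling.walkWinding_closed_eq_of_walk W Lv fun z hz ↦ ?_
    rw [hLv, Walk.support_copy] at hz
    exact hX5 z hz
  have hB4 : walkWinding W ((8 : ℤ) • db.1) = walkWinding W (opt 3 db) := by
    refine WeakBeurling.walkWinding_closed_eq_of_walk W (spur 3 db) fun z hz ↦ ?_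
    obtain ⟨t, ht, rfl⟩ := mem_support_spur.1 hz
    rcases Nat.eq_zero_or_pos t with rfl | ht0
    · simpa using hX1 db.1 hb2
    · by_cases ht2 : t = 2
      · subst ht2
        exact hX4
      · exact hX3 db hdb' hbc hba t ht0 ht ht2
  ------------------------------------------------------------------
  -- the crossing bracket: traversal counts of `W` at `m = opt 2 dd`
  have hm1 : opt 2 dd ∉ (spur 2 dc).support := by
    intro h1
    obtain ⟨t', ht', he'⟩ := mem_support_spur.1 h1
    rcases Nat.eq_zero_or_pos t' with rfl | ht'0
    · simp only [Nat.cast_zero, zero_smul, add_zero] at he'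
      rcases eq_ends_of_eq_smul (t := 2) (by omega) he' with ⟨h0, -⟩ | ⟨h8, -⟩ <;> omega
    · rcases eq_or_rev_of_interior_eq (t := 2) (by norm_num) (by norm_num) ht'0 (by omega) he'
        with ⟨h₁, h₂, -⟩ | ⟨-, -, h₃⟩
      · exact hdcne (Prod.ext h₁ h₂)
      · omega
  have hm3 : opt 2 dd ∉ (spur 2 da).support := by
    intro h3
    obtain ⟨t', ht', he'⟩ := mem_support_spur.1 h3
    rcases Nat.eq_zero_or_pos t' with rfl | ht'0
    · simp only [Nat.cast_zero, zero_smul, add_zero] at he'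
      rcases eq_ends_of_eq_smul (t := 2) (by omega) he' with ⟨h0, -⟩ | ⟨h8, -⟩ <;> omega
    · rcases eq_or_rev_of_interior_eq (t := 2) (by norm_num) (by norm_num) ht'0 (by omega) he'
        with ⟨h₁, h₂, -⟩ | ⟨-, -, h₃⟩
      · exact hdane (Prod.ext h₁ h₂)
      · omega
  have hm4 : opt 2 dd ∉ R₁.support := by
    intro h4
    rcases mem_support_refine h4 with ⟨z', hz', he'⟩ | ⟨y₁, y₁', he₁, hy₁, t', ht0', ht8', he'⟩
    · rcases eq_ends_of_eq_smul (t := 2) (by omega) he' with ⟨h0, -⟩ | ⟨h8, -⟩ <;> omega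
    · refine hdd'.2 ?_
      rw [show s(dd.1, dd.1 + dir dd.2) = s(y₁, y₁ + dir (dirOf y₁ y₁')) from
        edge_eq_of_interior_eq (t := 2) (by norm_num) (by norm_num) ht0' ht8' he', hy₁]
      exact hP₁E he₁
  -- pieces of the offset-2 loop containing `m`: positions `id - ic - 1` and `id - ic`
  have hj₂eq : (succ E)^[id - ic] dc = dd := by
    rw [← hdc, ← Function.iterate_add_apply, Nat.sub_add_cancel (by omega), hdd]
  have hj₁eq : succ E ((succ E)^[id - ic - 1] dc) = dd := by
    have : (succ E)^[id - ic - 1 + 1] dc = dd := by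
      rw [← hdc, ← Function.iterate_add_apply, show id - ic - 1 + 1 + ic = id by omega, hdd]
    rwa [Function.iterate_succ_apply'] at this
  have hmj : ∀ j, j < N - ic + ia → j ≠ id - ic - 1 → j ≠ id - ic →
      opt 2 dd ∉ (oconn E 2 ho2 ((succ E)^[j] dc)).support := by
    intro j hj hj1 hj2 hz
    have hp1 := hpos j hj.le id (by omega)
    have hp2 := hpos (j + 1) hj id (by omega)
    rw [Function.iterate_succ_apply'] at hp2
    generalize (succ E)^[j] dc = e' at hz hp1 hp2
    obtain ⟨x, k⟩ := e'
    rcases mem_support_oconn_cases (by norm_num) hz with he' | he' | ⟨a, b, hab, ha0, ha8, hb0, hb8⟩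
    · have := opt_injective (by norm_num) (by norm_num) he'
      rcases hp1 (this ▸ hdd.symm) with h' | h' <;> omega
    · have := opt_injective (by norm_num) (by norm_num) he'
      rcases hp2 (this ▸ hdd.symm) with h' | h' <;> omega
    · have h1 := mod_ne_zero_of_interior hab ha0 ha8 hb0 hb8
      have h2 := opt_mod_eq_zero 2 dd
      omega
  -- the signed counts
  have hSv : (W.darts.map fun e ↦ vCross (opt 2 dd - Pi.single 0 1) e.fst e.snd).sum =
      (if dd.2 = 0 then 1 else 0) - (if dd.2 = 2 then 1 else 0) := by
    have hu : opt 2 dd - Pi.single 0 1 + Pi.single 0 1 = opt 2 dd := sub_add_cancel _ _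
    rw [hW, sum_map_darts_append, sum_map_darts_append, sum_map_darts_append,
      sum_map_darts_reverse_of_antisymm _ _ (vCross_swap _),
      sum_vCross_eq_zero_of_notMem (spur 2 dc) (Or.inl (hu.symm ▸ hm1)),
      sum_vCross_eq_zero_of_notMem (spur 2 da) (Or.inl (hu.symm ▸ hm3)),
      sum_vCross_eq_zero_of_notMem R₁ (Or.inl (hu.symm ▸ hm4)), hLw, sum_map_darts_copy,
      sum_map_darts_oloop]
    rw [Finset.sum_eq_add (id - ic - 1) (id - ic) (by omega)]
    · have e1 : ((oconn E 2 ho2 ((succ E)^[id - ic - 1] dc)).darts.map fun e ↦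
          vCross (opt 2 dd - Pi.single 0 1) e.fst e.snd).sum = if dd.2 = 2 then -1 else 0 := by
        rw [← hj₁eq, ← Prod.mk.eta (p := (succ E)^[id - ic - 1] dc)]
        exact sum_vCross_oconn_end (by norm_num) ho2 (by norm_num) _ _
      have e2 : ((oconn E 2 ho2 ((succ E)^[id - ic] dc)).darts.map fun e ↦
          vCross (opt 2 dd - Pi.single 0 1) e.fst e.snd).sum = if dd.2 = 0 then 1 else 0 := by
        rw [hj₂eq, ← Prod.mk.eta (p := dd)]
        exact sum_vCross_oconn_start (by norm_num) ho2 (by norm_num) _ _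
      rw [e1, e2]
      split_ifs <;> omega
    · intro j hj hjne
      exact sum_vCross_eq_zero_of_notMem _
        (Or.inl (hu.symm ▸ hmj j (Finset.mem_range.1 hj) hjne.1 hjne.2))
    · intro hj; exact absurd (Finset.mem_range.2 (by omega)) hj
    · intro hj; exact absurd (Finset.mem_range.2 (by omega)) hj
  have hSh : (W.darts.map fun e ↦ hCross (opt 2 dd - Pi.single 1 1) e.fst e.snd).sum =
      (if dd.2 = 3 then 1 else 0) - (if dd.2 = 1 then 1 else 0) := by
    have hu : opt 2 dd - Pi.single 1 1 + Pi.single 1 1 = opt 2 dd := sub_add_cancel _ _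
    rw [hW, sum_map_darts_append, sum_map_darts_append, sum_map_darts_append,
      sum_map_darts_reverse_of_antisymm _ _ (hCross_swap _),
      sum_hCross_eq_zero_of_notMem (spur 2 dc) (Or.inl (hu.symm ▸ hm1)),
      sum_hCross_eq_zero_of_notMem (spur 2 da) (Or.inl (hu.symm ▸ hm3)),
      sum_hCross_eq_zero_of_notMem R₁ (Or.inl (hu.symm ▸ hm4)), hLw, sum_map_darts_copy,
      sum_map_darts_oloop]
    rw [Finset.sum_eq_add (id - ic - 1) (id - ic) (by omega)]
    · have e1 : ((oconn E 2 ho2 ((succ E)^[id - ic - 1] dc)).darts.map fun e ↦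
          hCross (opt 2 dd - Pi.single 1 1) e.fst e.snd).sum = if dd.2 = 1 then -1 else 0 := by
        rw [← hj₁eq, ← Prod.mk.eta (p := (succ E)^[id - ic - 1] dc)]
        exact sum_hCross_oconn_end (by norm_num) ho2 (by norm_num) _ _
      have e2 : ((oconn E 2 ho2 ((succ E)^[id - ic] dc)).darts.map fun e ↦
          hCross (opt 2 dd - Pi.single 1 1) e.fst e.snd).sum = if dd.2 = 3 then 1 else 0 := by
        rw [hj₂eq, ← Prod.mk.eta (p := dd)]
        exact sum_hCross_oconn_start (by norm_num) ho2 (by norm_num) _ _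
      rw [e1, e2]
      split_ifs <;> omega
    · intro j hj hjne
      exact sum_hCross_eq_zero_of_notMem _
        (Or.inl (hu.symm ▸ hmj j (Finset.mem_range.1 hj) hjne.1 hjne.2))
    · intro hj; exact absurd (Finset.mem_range.2 (by omega)) hj
    · intro hj; exact absurd (Finset.mem_range.2 (by omega)) hj
  ------------------------------------------------------------------
  -- the crossing bracket itself
  have hp0 : (8 : ℤ) • dd.1 ∉ W.support := hX1 dd.1 hd2
  have hp1 : (8 : ℤ) • dd.1 + ((1 : ℕ) : ℤ) • dir dd.2 ∉ W.support :=
    hX3 dd hdd' hdcne hdane 1 (by norm_num) (by norm_num) (by norm_num)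
  have hp3 : (8 : ℤ) • dd.1 + ((3 : ℕ) : ℤ) • dir dd.2 ∉ W.support :=
    hX3 dd hdd' hdcne hdane 3 (by norm_num) (by norm_num) (by norm_num)
  have hB2 : walkWinding W (opt 3 dd) = walkWinding W ((8 : ℤ) • dd.1) - 1 := by
    have h01 : walkWinding W ((8 : ℤ) • dd.1) =
        walkWinding W ((8 : ℤ) • dd.1 + ((1 : ℕ) : ℤ) • dir dd.2) :=
      WeakBeurling.walkWinding_closed_eq_of_stepKind (stepKind_of_adj (by simpa using adj_add_dir _ dd.2))
        hp0 hp1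
    obtain ⟨xd, kd⟩ := dd
    dsimp only at *
    rcases fin_four_eq' kd with rfl | rfl | rfl | rfl
    · -- east: `p1 = m - e₀`, `p3 = m + e₀`
      have em : opt 2 (xd, 0) - Pi.single 0 1 = (8 : ℤ) • xd + ((1 : ℕ) : ℤ) • dir 0 := by
        simp [opt, Site.eq_iff_two]; omega
      have ep3 : opt 2 (xd, 0) + Pi.single 0 1 = (8 : ℤ) • xd + ((3 : ℕ) : ℤ) • dir 0 := by
        simp [opt, Site.eq_iff_two]; omega
      have eo3 : opt 3 (xd, 0) = (8 : ℤ) • xd + ((3 : ℕ) : ℤ) • dir 0 := by simp [opt]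
      have s1 := walkWinding_sub_walkWinding_right W (opt 2 (xd, 0) - Pi.single 0 1)
      rw [sub_add_cancel, hSv, em] at s1
      have s2 := walkWinding_sub_walkWinding_right W (opt 2 (xd, 0))
      rw [sum_vCross_eq_zero_of_notMem W (Or.inl (ep3 ▸ hp3)), ep3] at s2
      simp only [if_true, Fin.isValue] at s1
      rw [eo3, h01]
      have : ((0 : Fin 4) = 2) = False := by decide
      simp only [this, if_false, sub_zero] at s1
      linarith
    · -- north: `p1 = m - e₁`, `p3 = m + e₁`
      have em : opt 2 (xd, 1) - Pi.single 1 1 = (8 : ℤ) • xd + ((1 : ℕ) : ℤ) • dir 1 := by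
        simp [opt, Site.eq_iff_two]; omega
      have ep3 : opt 2 (xd, 1) + Pi.single 1 1 = (8 : ℤ) • xd + ((3 : ℕ) : ℤ) • dir 1 := by
        simp [opt, Site.eq_iff_two]; omega
      have eo3 : opt 3 (xd, 1) = (8 : ℤ) • xd + ((3 : ℕ) : ℤ) • dir 1 := by simp [opt]
      have s1 := walkWinding_sub_walkWinding_up_closed W (opt 2 (xd, 1) - Pi.single 1 1)
      rw [sub_add_cancel, hSh, em] at s1
      have s2 := walkWinding_sub_walkWinding_up_closed W (opt 2 (xd, 1))
      rw [sum_hCross_eq_zero_of_notMem W (Or.inl (ep3 ▸ hp3)), ep3] at s2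
      rw [eo3, h01]
      have h13 : ((1 : Fin 4) = 3) = False := by decide
      simp only [h13, if_false, if_true, zero_sub, neg_neg] at s1
      linarith
    · -- west: `p1 = m + e₀`, `p3 = m - e₀`
      have ep1 : opt 2 (xd, 2) + Pi.single 0 1 = (8 : ℤ) • xd + ((1 : ℕ) : ℤ) • dir 2 := by
        simp [opt, Site.eq_iff_two]; omega
      have em : opt 2 (xd, 2) - Pi.single 0 1 = (8 : ℤ) • xd + ((3 : ℕ) : ℤ) • dir 2 := by
        simp [opt, Site.eq_iff_two]; omega
      have eo3 : opt 3 (xd, 2) = (8 : ℤ) • xd + ((3 : ℕ) : ℤ) • dir 2 := by simp [opt]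
      have s1 := walkWinding_sub_walkWinding_right W (opt 2 (xd, 2))
      rw [sum_vCross_eq_zero_of_notMem W (Or.inl (ep1 ▸ hp1)), ep1] at s1
      have s2 := walkWinding_sub_walkWinding_right W (opt 2 (xd, 2) - Pi.single 0 1)
      rw [sub_add_cancel, hSv, em] at s2
      rw [eo3, h01]
      have h20 : ((2 : Fin 4) = 0) = False := by decide
      simp only [h20, if_false, if_true, zero_sub] at s2
      linarith
    · -- south: `p1 = m + e₁`, `p3 = m - e₁`
      have ep1 : opt 2 (xd, 3) + Pi.single 1 1 = (8 : ℤ) • xd + ((1 : ℕ) : ℤ) • dir 3 := by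
        simp [opt, Site.eq_iff_two]; omega
      have em : opt 2 (xd, 3) - Pi.single 1 1 = (8 : ℤ) • xd + ((3 : ℕ) : ℤ) • dir 3 := by
        simp [opt, Site.eq_iff_two]; omega
      have eo3 : opt 3 (xd, 3) = (8 : ℤ) • xd + ((3 : ℕ) : ℤ) • dir 3 := by simp [opt]
      have s1 := walkWinding_sub_walkWinding_up_closed W (opt 2 (xd, 3))
      rw [sum_hCross_eq_zero_of_notMem W (Or.inl (ep1 ▸ hp1)), ep1] at s1
      have s2 := walkWinding_sub_walkWinding_up_closed W (opt 2 (xd, 3) - Pi.single 1 1)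
      rw [sub_add_cancel, hSh, em] at s2
      rw [eo3, h01]
      have h31 : ((3 : Fin 4) = 1) = False := by decide
      simp only [h31, if_false, if_true, sub_zero] at s2
      linarith
  linarith [hB1, hB2, hB3, hB4]

/-- **Separation lemma, vertex form**: in a presented rectangle, every walk of `⟨E⟩` from a vertex
of the arc `(ab) = arcVerts 0` to a vertex of `(cd) = arcVerts 2` meets every walk of `⟨E⟩` from a
vertex of `(bc) = arcVerts 1` to a vertex of `(da) = arcVerts 3`.
[cite: ChelkakDuminilCopinHongler2016, §2.1 and §4 (planarity of discrete domains)] -/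
theorem IsRect.exists_mem_support_inter_of_mem_arcVerts (h : IsRect E d₀ n)
    {xa xb xc xd : Site 2} (hxa : xa ∈ arcVerts E d₀ n 0) (hxb : xb ∈ arcVerts E d₀ n 1)
    (hxc : xc ∈ arcVerts E d₀ n 2) (hxd : xd ∈ arcVerts E d₀ n 3)
    (P₁ : (fromEdgeSet (↑E : Set (Sym2 (Site 2)))).Walk xa xc)
    (P₂ : (fromEdgeSet (↑E : Set (Sym2 (Site 2)))).Walk xb xd) :
    ∃ z ∈ P₁.support, z ∈ P₂.support := by
  obtain ⟨ia, hia1, hia2, rfl⟩ := hxa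
  obtain ⟨ib, hib1, hib2, rfl⟩ := hxb
  obtain ⟨ic, hic1, hic2, rfl⟩ := hxc
  obtain ⟨id, hid1, hid2, rfl⟩ := hxd
  have l0 : lo n 0 = 0 := rfl
  have l1 : lo n 1 = n 0 := rfl
  have l2 : lo n 2 = n 0 + n 1 := rfl
  have l3 : lo n 3 = n 0 + n 1 + n 2 := rfl
  rw [l0] at hia2
  rw [l1] at hib1 hib2
  rw [l2] at hic1 hic2
  rw [l3] at hid1 hid2
  exact h.exists_mem_support_inter (by omega) hib1 hib2 hic1 hic2 hid1 hid2 P₁ P₂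

end Separation

end DiscreteRect

end Literature.Probability.LatticeModels

end
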